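import Summits.CriticalPhenomena.CardyFormulaZ2.Theses.CardySelfRefinement
import Summits.CriticalPhenomena.CardyFormulaZ2.Theorems.LagHandOff.Negative.Structure
import Literature.Probability.Percolation.QuadCrossingSpaceZ2
import Literature.Probability.Percolation.QuadCrossingSpaceProofs
import Literature.Probability.Percolation.QuadCrossingLowerSets
import Literature.Probability.Percolation.QuadCrossingCrossedEventInterior
import Mathlib.MeasureTheory.Measure.LevyProkhorovMetric
import HarnessLib

/-!
# Disproof work file for crux `ScaleInvariantLimits` (stmt-CriticalPhenomena-10265, route
# `CardySelfRefinement`, sub-problem `CardyFormulaZ2`) — standing adversary (refuter `cdisprove`)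

The crux (rank 0, the route's target `X`):

  `ScaleInvariantLimits : ∀ μ ∈ subseqQuadLimits univ, ∀ t > 0, dilateLaw t _ μ = μ`

— every subsequential weak limit `μ` (along meshes `δₖ → 0⁺`) of the laws of critical bond-`ℤ²`
percolation in Schramm–Smirnov's quad-crossing space `ℋ_ℂ` is invariant under every dilation `S_t`.
Prose lives in docstrings only; everything below is checked (no `sorry`).

## Findings (index)

* §0 `instT2Space`, `instMetrizableSpace`, `instHasOuterApproxClosed`, `instCompactSpace` — THE ARENA
  IS GENUINE.  Every junk channel a refuter could hope for is closed by theorems already in the tree: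
  `ℋ_ℂ` is compact metrizable Hausdorff (`SchrammSmirnov2011_thm_1_4_holds`, `QuadConfig.compactSpace`),
  so weak limits of laws are unique and laws are determined by bounded continuous test functions;
  `Λ := subseqQuadLimits univ ≠ ∅` and consists of probability measures
  (`LagHandOff.Negative.subseqQuadLimits_nonempty`, `isProbabilityMeasure_of_isSubseqQuadLimit`,
  via `measurable_z2QuadConfig`); the laws are genuine product-Bernoulli push-forwards
  (`bondPercolation = setBer(E(ℤ²), 1/2)`), `configOf` is SS11's `S_ω`.  Hence the Lean statement IS
  the open scale-invariance problem for bond-`ℤ²` (DKKMO 2020 §1.1; GPS 2013 §2.3) — neither vacuous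
  nor junk-refutable.
* §1 `dilateLaw_mem_subseqQuadLimits` — `Λ` is `S_t`-STABLE (`S_t μ_δ = μ_{tδ}`,
  `dilateLaw_squareCrossingLaw`, + weak continuity of `S_t`, `continuous_dilateLaw`): the crux says
  exactly that the natural action of `(ℝ₊,·)` on the compact set `Λ` is trivial.  Group bookkeeping the
  prover of `TwoLagsAllLags` needs: `dilateLaw_dilateLaw`, `dilateLaw_one`, `dilateLaw_inv_eq_self`,
  `dilateLaw_mul_eq_self` (the stabiliser of a law is a subgroup of `ℝˣ`); `scaleInvariantLimits_of_subsingleton` (uniqueness of the limit ⇒ `X`).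
  `map_eq_self_of_mem_subseqQuadLimits` — TRANSFER PRINCIPLE: a weakly continuous self-map of laws
  fixing every discrete law `μ_δ` fixes every `μ ∈ Λ`.  This is why every LATTICE symmetry is free
  (`map_rotate_pi_div_two_eq_self`, `map_conj_eq_self`, §3 `dilateLaw_neg_one_eq_self`) and why the
  dilations are not: `S_t` PERMUTES the discrete laws (`μ_δ ↦ μ_{tδ}`) and fixes none.
* §2 LOAD-BEARING ANALYSIS — `scaleInvariantLimits_false_without_limitHyp`: dropping `μ ∈ Λ` makes the
  statement FALSE (`ScaleInvariantLimitsWithoutLimitHyp`).  Witness: the Dirac law at `S₀ = S_ω`, `ω` =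
  the single open edge `[0,1]` of `ℤ²` at mesh `1`; `S_2 S₀ ≠ S₀` (`dilate_two_S0_ne`), separated by the
  crossing event of the rectangle `[0,2]×[-1,1]` (`wideRect_mem_dilate_two_S0`, `wideRect_not_mem_S0`).
  Corollaries: the dilations act non-trivially on `ℋ_ℂ` (`not_forall_dilate_eq_self`) and on its
  probability laws (`not_forall_probability_dilateLaw_eq`).  So any proof must use that `μ` is a limit
  OF THE PERCOLATION LAWS; nothing softer (mass one, support conditions) can suffice.
* §3 `scaleInvariantLimitsNonzero_iff` — `t > 0` is NOT load-bearing: the variant over all `t ≠ 0` is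
  EQUIVALENT to the crux, because `S_{-1}` = rotation by `π` = (quarter turn)² is a symmetry of every
  `δℤ²` (`z2QuadLaw_map_dilate_neg_one`, `dilate_neg_one_eq`), hence of every `μ ∈ Λ`.
* §4 `scaleInvariantLimits_iff_asymptotic` — the docstring's informal gloss "equivalently
  `d(μ_δ, μ_{λδ}) → 0`" made a THEOREM without choosing a metric: the crux ⇔
  `AsymptoticLagInvariance` (for every `t > 0`, every positive null mesh sequence and every bounded
  continuous `f : ℋ_ℂ → ℝ`, `∫ f dμ_{δₖ} − ∫ f dμ_{tδₖ} → 0`).  This is the precise interface between the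
  route's lattice engine (`RussoDrift`/`LagsToInvariance`, stated with crossing indicators, which are
  NOT continuous — they need the SS11 §5 continuity-set input on top) and `X`.

* §5 `exists_dilateLaw_two_invariant_cesaroLimit` — the natural WEAKENING is TRUE (Krylov–Bogolyubov over
  dyadic scales): a weak subsequential limit `ν` of the Cesàro averages `(n+1)⁻¹ Σ_{j≤n} μ_{2^{-(j+1)}}`
  exists and is an `S_2`-INVARIANT probability law (`S_2 ν_n − ν_n = (n+1)⁻¹(μ_1 − μ_{2^{-n-1}})`,
  `abs_testAgainstNN_dilateLaw_two_dyadicCesaro_sub_le`).  So a dilation-invariant law MADE OF the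
  critical bond-`ℤ²` laws exists in the closed convex hull of the scaling orbit; `X` asserts that the
  invariant laws exhaust `Λ` itself.  Consequently no convex/averaged functional of the laws can ever
  witness `¬X` — a refutation must separate `Λ` from its convex hull (an extremality statement).

* §6 `map_translate_eq_self_of_mem_subseqQuadLimits` — FREE SYMMETRY 4, PROVED: every `μ ∈ Λ` is
  invariant under EVERY translation of the plane (`continuous_translate₂`: the action of `ℂ` on `ℋ_ℂ`
  is jointly continuous, checked on the subbase with SS11's `(esb)`; then uniform continuity of
  `v ↦ f ∘ T_v` on the compact `ℋ_ℂ` and exact invariance under `δₖℤ²`).  Hence, of the similarity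
  group, translations / quarter-turns / reflections are free, all rotations are DKKMO (`RotationInput`),
  and ONLY THE DILATIONS are the crux — the obstruction is isolated exactly.

* §7 `exists_rotationInvariant_lagTwo_not_lagThree` — an abstract LIMIT-CYCLE LAW on `ℋ_ℂ` exists:
  the Dirac law at `S⋆ = crossConfig {‖z‖ = 2ⁿ}` (quads crossed inside the dyadic circles) is invariant
  under ALL rotations and under `S_2`, but `S_3 S⋆ ≠ S⋆` (`dilate_three_Sstar_ne`, test quad
  `[-1/10,1/10]×[9/10,11/10]` hugging the unit circle).  So: the stabiliser of a law can be exactly a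
  lattice `2^ℤ`; rotation invariance implies no dilation invariance (`not_dilationInvariant_of_rotationInvariant`
  — the item's "DKKMO does not exclude an RG limit cycle", as a theorem on single laws); and lag `3` is
  load-bearing in `TwoLagsAllLags` even granted rotations (`not_allLags_of_rotation_and_lagTwo`).
  Generic tool: `crossConfig E` with transport `mapHomeomorph_crossConfig` (`g · S_E = S_{gE}`).

* §8 `subseqQuadLimits_subsingleton_or_infinite`, `isPreconnected_subseqQuadLimits` — NO FINITE LIMIT
  CYCLE: `δ ↦ μ_δ` is weakly continuous on `(0,∞)` (`continuousOn_z2QuadLaw`: pointwise continuity of the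
  dilation action + dominated convergence), so `Λ = ⋂ₙ closure{μ_δ : 0 < δ < 1/(n+1)}`
  (`setOf_mem_subseqQuadLimits_eq_iInter`) is a decreasing intersection of continua in the compact
  metrizable space of probability laws, hence CONNECTED (`isPreconnected_iInter_of_antitone_isCompact`);
  a connected Hausdorff set is one point or infinite.  The item's own failure picture ("several limit
  points permuted by `S_t`") is therefore IMPOSSIBLE in finite form
  (`not_finite_nontrivial_subseqQuadLimits`), and ANY failure of `X` forces infinitely many distinct
  subsequential limits (`infinite_subseqQuadLimits_of_not_scaleInvariantLimits`): `¬X` is at least as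
  strong as "the scaling limit of bond-`ℤ²` crossing probabilities fails to exist in a continuum of ways".

## Why the crux resists (cycle-1 verdict: NO KILL, and none is available in Lean or in print)

1. A Lean refutation `¬X` must EXHIBIT `μ ∈ Λ` and `t > 0` with `S_t μ ≠ μ`, i.e. two distinct
   subsequential scaling limits of critical bond-`ℤ²` crossing laws related by a dilation — an RG
   "limit cycle" (log-periodic dependence of `μ_δ` on `log δ`).  No element of `Λ` is constructible
   (only `Λ ≠ ∅` by compactness), and no crossing probability of bond-`ℤ²` has a computable limit in the
   tree or in print except those fixed by symmetry/duality (e.g. `P(square crossed) → 1/2`, which is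
   dilation invariant and so useless for a kill).
2. Junk channels: all closed (§0).  The only hypothesis, `μ ∈ Λ`, is load-bearing (§2); `t > 0` is
   not (§3); `p = 1/2` is not "load-bearing" in the refuter's sense either — off criticality the
   analogue of `X` is TRUE for trivial reasons (exponential decay drives `μ_δ` to the Dirac law at
   `none`/`all`, both `S_t`-fixed; not formalised here).
3. In print: scale invariance of the `ℤ²` subsequential limits is flagged OPEN by DKKMO 2020 (§1.1,
   rotation invariance proved, "scale and translation invariance … missing to deduce conformal
   invariance" paraphrase) and GPS 2013 §2.3; no counterexample MECHANISM is known on a Euclidean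
   lattice — discrete scale invariance / log-periodic corrections (Sornette 1998, Phys. Rep. 297)
   require a built-in hierarchy (hierarchical / fractal lattices, Derrida–Itzykson–Luck 1984), and the
   universality numerics for bond-`ℤ²` crossing probabilities (Langlands–Pouliot–Saint-Aubin 1994,
   Ziff 1992–2011) agree with Cardy/Watts to `10⁻³–10⁻⁴` across decades of sizes, which a limit cycle of
   non-negligible amplitude would violate.  So a substantive refutation would overturn the field's
   best-tested conjecture; a misstated-type refutation is excluded by §0.
4. What WOULD move the needle (for the provers, not the refuter): the transfer principle (§1) shows the
   gap exactly — one needs an ASYMPTOTIC symmetry `μ_{tδ} ≈ μ_δ` (§4), which no exact lattice identity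
   provides; the route's Russo interpolation is one candidate, DKKMO-style coupling across scales
   another.  Natural targets I could not decide and leave to later cycles: (a) `∃ μ ∈ Λ` dilation
   invariant (existence of ONE scale-invariant subsequential limit — open as far as searched; a
   Cesàro-in-`log δ` average gives an invariant law only in the closed convex hull of `Λ`);
   (b) [DONE in §6] translation invariance of every `μ ∈ Λ` by ALL `v ∈ ℂ` — a positive lemma for
   the `LagHandOff`/`SymmetryUpgrade` provers, recorded here because it marks precisely which
   similarities are free (translations, quarter-turns, reflections), which are deep-but-done (all
   rotations: DKKMO = `RotationInput`) and which are the crux (dilations).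

## Provenance

Cycle 1 (2026-08-16, refuter-cdisprove-stmt-CriticalPhenomena-10265-0).  Imports the landed
`LagHandOff.Negative.Structure` (for `Λ ≠ ∅`, compactness extraction
`exists_mem_subseqQuadLimits_tendsto_subseq`) and the Literature files `QuadCrossingSpaceZ2`
(dilation equivariance, lattice symmetries of `μ_δ`), `QuadCrossingSpaceProofs` (Thm 1.4).
-/

noncomputable section

open MeasureTheory Filter Set Topology
open scoped NNReal ENNReal BoundedContinuousFunction
open Literature.Probability.Percolation Literature.Probability.LatticeModels
open Literature.Probability.Percolation.QuadCrossing
open Summit.CriticalPhenomena.CardyFormulaZ2.Theses.CardySelfRefinement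

namespace Summit.CriticalPhenomena.CardyFormulaZ2.Cruxes.ScaleInvariantLimits.Disproof

/-! ## §0  The arena is genuine: instances on `ℋ_ℂ` from Schramm–Smirnov Thm 1.4 (proved in tree) -/

/-- `ℋ_ℂ` is Hausdorff (tree: `SchrammSmirnov2011_thm_1_4_holds`). [cite: SchrammSmirnov2011, Thm. 1.4] -/
instance instT2Space : T2Space (QuadConfig (univ : Set ℂ)) :=
  (SchrammSmirnov2011_thm_1_4_holds univ isOpen_univ univ_nonempty).1.2.2

/-- `ℋ_ℂ` is metrizable (tree: `SchrammSmirnov2011_thm_1_4_holds`). [cite: SchrammSmirnov2011, Thm. 1.4] -/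
instance instMetrizableSpace : TopologicalSpace.MetrizableSpace (QuadConfig (univ : Set ℂ)) :=
  (SchrammSmirnov2011_thm_1_4_holds univ isOpen_univ univ_nonempty).1.2.1

/-- Hence closed sets have outer continuous approximations, so finite Borel measures on `ℋ_ℂ` are
determined by bounded continuous test functions and weak limits are unique. [folklore] -/
instance instHasOuterApproxClosed : HasOuterApproxClosed (QuadConfig (univ : Set ℂ)) :=
  inferInstance

/-- `ℋ_ℂ` is compact (tree: `QuadConfig.compactSpace`, Alexander subbase). [cite: SchrammSmirnov2011, Thm. 1.4] -/
instance instCompactSpace : CompactSpace (QuadConfig (univ : Set ℂ)) := QuadConfig.compactSpace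

/-- sanity: singletons are measurable, laws form a Hausdorff space. [folklore] -/
example : MeasurableSingletonClass (QuadConfig (univ : Set ℂ)) := inferInstance
example : T2Space (FiniteMeasure (QuadConfig (univ : Set ℂ))) := inferInstance
example : CompactSpace (QuadConfig (univ : Set ℂ)) := inferInstance

/-! ## §1  Structure of the crux: `S_t` acts on `Λ`; the crux says the action is trivial -/

/-- The crux, unfolded. [folklore] -/
theorem scaleInvariantLimits_iff :
    ScaleInvariantLimits ↔ ∀ μ ∈ subseqQuadLimits (univ : Set ℂ), ∀ (t : ℝ) (ht : 0 < t),
      dilateLaw t ht.ne' μ = μ := Iff.rfl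

/-- `S_t` is continuous on `ℋ_ℂ`. [folklore] -/
theorem continuous_dilate (t : ℝ) (ht : t ≠ 0) :
    Continuous (QuadConfig.dilate t ht : QuadConfig (univ : Set ℂ) → QuadConfig univ) :=
  QuadConfig.continuous_mapHomeomorph _

/-- `dilateLaw t` is continuous for weak convergence. [folklore] -/
theorem continuous_dilateLaw (t : ℝ) (ht : t ≠ 0) :
    Continuous (dilateLaw t ht : FiniteMeasure (QuadConfig (univ : Set ℂ)) → _) :=
  FiniteMeasure.continuous_map (continuous_dilate t ht)

/-- Proof-irrelevant congruence in the scale parameter. [folklore] -/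
theorem dilateLaw_congr {s t : ℝ} (hs : s ≠ 0) (ht : t ≠ 0) (h : s = t)
    (μ : FiniteMeasure (QuadConfig (univ : Set ℂ))) : dilateLaw s hs μ = dilateLaw t ht μ := by
  subst h; rfl

/-- `S_s S_t = S_{st}` on laws. [folklore] -/
theorem dilateLaw_dilateLaw (s t : ℝ) (hs : s ≠ 0) (ht : t ≠ 0)
    (μ : FiniteMeasure (QuadConfig (univ : Set ℂ))) :
    dilateLaw s hs (dilateLaw t ht μ) = dilateLaw (s * t) (mul_ne_zero hs ht) μ := by
  apply FiniteMeasure.toMeasure_injective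
  rw [dilateLaw, dilateLaw, dilateLaw, FiniteMeasure.toMeasure_map, FiniteMeasure.toMeasure_map,
    FiniteMeasure.toMeasure_map,
    Measure.map_map (QuadConfig.measurable_dilate s hs) (QuadConfig.measurable_dilate t ht)]
  congr 1
  funext S
  exact QuadConfig.dilate_dilate s t hs ht S

/-- `S_1 = id` on laws. [folklore] -/
theorem dilateLaw_one (μ : FiniteMeasure (QuadConfig (univ : Set ℂ))) :
    dilateLaw 1 one_ne_zero μ = μ := by
  apply FiniteMeasure.toMeasure_injective
  rw [dilateLaw, FiniteMeasure.toMeasure_map]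
  have : (QuadConfig.dilate 1 one_ne_zero : QuadConfig (univ : Set ℂ) → _) = id :=
    funext QuadConfig.dilate_one
  rw [this, Measure.map_id]

/-- The stabiliser `{t : S_t μ = μ}` is closed under inverses. [folklore] -/
theorem dilateLaw_inv_eq_self {μ : FiniteMeasure (QuadConfig (univ : Set ℂ))} {t : ℝ} (ht : t ≠ 0)
    (h : dilateLaw t ht μ = μ) : dilateLaw t⁻¹ (inv_ne_zero ht) μ = μ := by
  conv_lhs => rw [← h]
  rw [dilateLaw_dilateLaw, dilateLaw_congr _ one_ne_zero (inv_mul_cancel₀ ht), dilateLaw_one]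

/-- The stabiliser is closed under products. [folklore] -/
theorem dilateLaw_mul_eq_self {μ : FiniteMeasure (QuadConfig (univ : Set ℂ))} {s t : ℝ}
    (hs : s ≠ 0) (ht : t ≠ 0) (h₁ : dilateLaw s hs μ = μ) (h₂ : dilateLaw t ht μ = μ) :
    dilateLaw (s * t) (mul_ne_zero hs ht) μ = μ := by
  rw [← dilateLaw_dilateLaw s t hs ht, h₂, h₁]

/-- **`dilateLaw t μ_δ = μ_{tδ}`** for the laws of the crux (`squareCrossingLaw`, the `√2`-scaled
drawing): the discrete laws are permuted, never fixed, by the dilations. [folklore] -/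
theorem dilateLaw_squareCrossingLaw {t : ℝ} (ht : t ≠ 0) (δ : ℝ) :
    dilateLaw t ht (squareCrossingLaw univ δ) = squareCrossingLaw univ (t * δ) := by
  rw [squareCrossingLaw_eq_z2QuadLaw, squareCrossingLaw_eq_z2QuadLaw, dilateLaw_z2QuadLaw, mul_assoc]

/-- **`Λ` is `S_t`-stable**: a dilate of a subsequential limit is a subsequential limit (along the
dilated meshes).  So the crux is exactly the statement that the natural action of `(ℝ₊, ·)` on the
compact set `Λ` is trivial. [folklore] -/
theorem dilateLaw_mem_subseqQuadLimits {μ : FiniteMeasure (QuadConfig (univ : Set ℂ))}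
    (hμ : μ ∈ subseqQuadLimits (univ : Set ℂ)) {t : ℝ} (ht : 0 < t) :
    dilateLaw t ht.ne' μ ∈ subseqQuadLimits (univ : Set ℂ) := by
  obtain ⟨δs, hpos, h0, hlim⟩ := (isSubseqQuadLimit_iff univ μ).mp hμ
  refine (isSubseqQuadLimit_iff univ _).mpr ⟨fun k => t * δs k, fun k => mul_pos ht (hpos k), ?_, ?_⟩
  · simpa using h0.const_mul t
  · have hc : Tendsto (fun k => dilateLaw t ht.ne' (z2QuadLaw univ (δs k))) atTop
        (𝓝 (dilateLaw t ht.ne' μ)) := ((continuous_dilateLaw t ht.ne').tendsto μ).comp hlim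
    simpa only [dilateLaw_z2QuadLaw] using hc

/-- **Uniqueness implies the crux**: if `Λ` is a singleton (the scaling limit exists — CardyRotToConf
r3 / `LimitExists`-type statements) then, `Λ` being `S_t`-stable, every element is dilation
invariant.  So `X` is formally WEAKER than uniqueness (the converse fails for general flows: an
orbit may spiral onto a continuum of fixed points). [folklore] -/
theorem scaleInvariantLimits_of_subsingleton
    (h : (subseqQuadLimits (univ : Set ℂ)).Subsingleton) : ScaleInvariantLimits :=
  fun _ hμ _ ht => h (dilateLaw_mem_subseqQuadLimits hμ ht) hμ

/-- **Transfer principle (why every LATTICE symmetry is free and dilations are not)**: a weakly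
continuous self-map of the laws that fixes every discrete law `μ_δ`, `δ > 0`, fixes every
subsequential limit (uniqueness of weak limits on the metrizable `ℋ_ℂ`).  Dilations fail the
hypothesis: `S_t μ_δ = μ_{tδ}`. [folklore] -/
theorem map_eq_self_of_mem_subseqQuadLimits {T : QuadConfig (univ : Set ℂ) → QuadConfig (univ : Set ℂ)}
    (hT : Continuous T) (hinv : ∀ δ : ℝ, 0 < δ → (z2QuadLaw univ δ).map T = z2QuadLaw univ δ)
    {μ : FiniteMeasure (QuadConfig (univ : Set ℂ))} (hμ : μ ∈ subseqQuadLimits (univ : Set ℂ)) :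
    μ.map T = μ := by
  obtain ⟨δs, hpos, -, hlim⟩ := (isSubseqQuadLimit_iff univ μ).mp hμ
  have h1 : Tendsto (fun k => (z2QuadLaw univ (δs k)).map T) atTop (𝓝 (μ.map T)) :=
    ((FiniteMeasure.continuous_map hT).tendsto μ).comp hlim
  have h2 : (fun k => (z2QuadLaw univ (δs k)).map T) = fun k => z2QuadLaw univ (δs k) :=
    funext fun k => hinv _ (hpos k)
  rw [h2] at h1
  exact tendsto_nhds_unique h1 hlim

/-- Free symmetry 1: every subsequential limit is invariant under the quarter turn. [folklore] -/
theorem map_rotate_pi_div_two_eq_self {μ : FiniteMeasure (QuadConfig (univ : Set ℂ))}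
    (hμ : μ ∈ subseqQuadLimits (univ : Set ℂ)) :
    μ.map (QuadConfig.rotate (Real.pi / 2)) = μ :=
  map_eq_self_of_mem_subseqQuadLimits (QuadConfig.continuous_mapHomeomorph _)
    (fun δ _ => z2QuadLaw_map_rotate_pi_div_two δ) hμ

/-- Free symmetry 2: every subsequential limit is invariant under complex conjugation. [folklore] -/
theorem map_conj_eq_self {μ : FiniteMeasure (QuadConfig (univ : Set ℂ))}
    (hμ : μ ∈ subseqQuadLimits (univ : Set ℂ)) : μ.map QuadConfig.conj = μ :=
  map_eq_self_of_mem_subseqQuadLimits (QuadConfig.continuous_mapHomeomorph _)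
    (fun δ _ => z2QuadLaw_map_conj δ) hμ


/-! ## §2  LOAD-BEARING ANALYSIS: the hypothesis `μ ∈ Λ` cannot be dropped

`ScaleInvariantLimitsWithoutLimitHyp` = the crux with the subsequential-limit hypothesis deleted
(every finite Borel law on `ℋ_ℂ` is dilation invariant).  FALSE: the Dirac mass at the
configuration `S₀ = S_ω` of the single open edge `[0,1]` of `ℤ²` (mesh `1`) is moved by `S_2`,
because `S_2 S₀` crosses the `2 × 2` rectangle `[0,2] × [-1,1]` (by the drawn edge `[0,2]`) while
no configuration near it in `S₀` can (its right side stays at distance `> 1` from the origin, and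
everything `S₀` draws lies in the closed unit disc).  So ANY proof of the crux must use that `μ`
is a limit of the percolation laws — the dilations act non-trivially on `ℋ_ℂ` and on its laws. -/

/-- The crux with the hypothesis `μ ∈ subseqQuadLimits univ` dropped. [folklore] -/
def ScaleInvariantLimitsWithoutLimitHyp : Prop :=
  ∀ μ : FiniteMeasure (QuadConfig (univ : Set ℂ)), ∀ (t : ℝ) (ht : 0 < t), dilateLaw t ht.ne' μ = μ

/-- The east unit vector of `ℤ²`. [folklore] -/
def e0 : Site 2 := Pi.single 0 1

/-- `0 ∼ e₀` in `ℤ²`. [folklore] -/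
theorem adj_zero_e0 : (zdGraph 2).Adj 0 e0 :=
  (zdGraph_adj_iff 0 e0).mpr ⟨0, Or.inl (by simp [e0])⟩

/-- The witness configuration: exactly the edge `{0, e₀}` is open. [folklore] -/
def oneEdge : BondConfig (Site 2) := {s((0 : Site 2), e0)}

/-- `meshPoint δ 0 = 0`. [folklore] -/
theorem meshPoint_zero (δ : ℝ) : meshPoint δ (0 : Site 2) = 0 := by
  apply Complex.ext <;> simp

/-- `meshPoint δ e₀ = δ`. [folklore] -/
theorem meshPoint_e0 (δ : ℝ) : meshPoint δ e0 = (δ : ℂ) := by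
  apply Complex.ext <;> simp [e0]

/-- The drawn open edges of `oneEdge` at mesh `δ`: the segment `[0, δ]`. [folklore] -/
theorem openEdgeUnion_oneEdge (δ : ℝ) : openEdgeUnion δ oneEdge = segment ℝ (0 : ℂ) (δ : ℂ) := by
  ext w
  rw [mem_openEdgeUnion_iff]
  constructor
  · rintro ⟨x, y, -, hω, hw⟩
    have h : s(x, y) = s((0 : Site 2), e0) := Set.mem_singleton_iff.mp hω
    rcases Sym2.eq_iff.mp h with ⟨rfl, rfl⟩ | ⟨rfl, rfl⟩
    · simpa only [meshPoint_zero, meshPoint_e0] using hw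
    · rw [segment_symm]; simpa only [meshPoint_zero, meshPoint_e0] using hw
  · intro hw
    exact ⟨0, e0, adj_zero_e0, Set.mem_singleton _, by simpa only [meshPoint_zero, meshPoint_e0] using hw⟩

/-- At mesh `1` everything drawn lies in the closed unit disc. [folklore] -/
theorem openEdgeUnion_one_oneEdge_subset : openEdgeUnion 1 oneEdge ⊆ Metric.closedBall (0 : ℂ) 1 := by
  rw [openEdgeUnion_oneEdge]
  refine (convex_closedBall (0 : ℂ) 1).segment_subset (Metric.mem_closedBall_self zero_le_one) ?_
  simp

/-- The witness configuration of `ℋ_ℂ`: `S₀ = S_{oneEdge}` at mesh `1`. [folklore] -/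
def S0 : QuadConfig (univ : Set ℂ) := z2QuadConfig univ 1 oneEdge

/-- `S_2 S₀` is `oneEdge` drawn at mesh `2`. [folklore] -/
theorem dilate_two_S0 : QuadConfig.dilate 2 two_ne_zero S0 = z2QuadConfig univ 2 oneEdge := by
  have h := z2QuadConfig_mul (two_ne_zero) 1 oneEdge
  rw [mul_one] at h
  exact h.symm

/-- The test quad: the rectangle `[0,2] × [-1,1]`, `(x, y) ↦ 2x + (2y - 1) i`; its sides `0`/`2`
are the vertical sides `Re = 0` / `Re = 2`. [folklore] -/
def wideRect : Quad (univ : Set ℂ) where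
  toFun p := ((2 * (p.1 : ℝ) : ℝ) : ℂ) + ((2 * (p.2 : ℝ) - 1 : ℝ) : ℂ) * Complex.I
  continuous_toFun := by fun_prop
  injective_toFun := by
    rintro ⟨s, t⟩ ⟨s', t'⟩ h
    obtain ⟨h1, h2⟩ := Quad.ofReal_add_ofReal_mul_I_inj h
    refine Prod.ext (Subtype.ext ?_) (Subtype.ext ?_)
    · simpa using h1
    · simpa using h2
  range_subset := subset_univ _

/-- `wideRect (x, y) = 2x + (2y - 1) i`. [folklore] -/
theorem wideRect_apply (p : unitInterval × unitInterval) :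
    wideRect p = ((2 * (p.1 : ℝ) : ℝ) : ℂ) + ((2 * (p.2 : ℝ) - 1 : ℝ) : ℂ) * Complex.I := rfl

/-- `Re (wideRect (x, y)) = 2x`. [folklore] -/
theorem wideRect_re (p : unitInterval × unitInterval) : (wideRect p).re = 2 * (p.1 : ℝ) :=
  (Quad.re_im_ofReal_add_ofReal_mul_I _ _).1

/-- On the midline `y = 1/2` the rectangle is the real segment: `wideRect (x, ½) = 2x`. [folklore] -/
theorem wideRect_half (x : unitInterval) : wideRect (x, half) = ((2 * (x : ℝ) : ℝ) : ℂ) := by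
  rw [wideRect_apply, coe_half]
  norm_num

/-- The drawn edge `[0, 2]` is a crossing of `wideRect`. [folklore] -/
theorem isCrossing_wideRect_segment : wideRect.IsCrossing (segment ℝ (0 : ℂ) ((2 : ℝ) : ℂ)) := by
  refine ⟨?_, ?_, ?_, ?_, ?_⟩
  · rw [segment_eq_image]
    exact isCompact_Icc.image (by fun_prop)
  · exact (convex_segment _ _).isConnected ⟨0, left_mem_segment _ _ _⟩
  · intro w hw
    rw [segment_eq_image] at hw
    obtain ⟨θ, hθ, rfl⟩ := hw
    refine ⟨(⟨θ, hθ⟩, half), ?_⟩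
    rw [wideRect_half]
    push_cast
    simp [mul_comm]
  · refine ⟨0, left_mem_segment _ _ _, ?_⟩
    refine ⟨(0, half), rfl, ?_⟩
    rw [wideRect_half]; simp
  · refine ⟨((2 : ℝ) : ℂ), right_mem_segment _ _ _, ?_⟩
    refine ⟨(1, half), rfl, ?_⟩
    rw [wideRect_half]; simp

/-- `wideRect` is crossed by `S_2 S₀` (the drawn edge `[0,2]`). [folklore] -/
theorem wideRect_mem_dilate_two_S0 : wideRect ∈ QuadConfig.dilate 2 two_ne_zero S0 := by
  rw [dilate_two_S0]
  refine mem_z2QuadConfig_of_isCrossing isCrossing_wideRect_segment ?_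
  rw [openEdgeUnion_oneEdge]

/-- `wideRect` is NOT crossed by `S₀`: every configuration within uniform distance `1/2` of it
has its right side at distance `≥ 3/2` from the origin, outside the unit disc containing all that
`S₀` draws; so `wideRect ∉ closure (raw crossed quads) = S₀`. [folklore] -/
theorem wideRect_not_mem_S0 : wideRect ∉ S0 := by
  intro hmem
  have hcl : wideRect ∈ closure {Q : Quad (univ : Set ℂ) |
      ∃ K, Q.IsCrossing K ∧ K ⊆ openEdgeUnion 1 oneEdge} := by
    rw [← coe_z2QuadConfig]; exact hmem
  rw [Metric.mem_closure_iff] at hcl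
  obtain ⟨Q, ⟨K, hK, hKω⟩, hdist⟩ := hcl (1 / 2) (by norm_num)
  obtain ⟨w, hwK, hwside⟩ := hK.2.2.2.2
  obtain ⟨z, hz1, rfl⟩ : ∃ z : unitInterval × unitInterval, z.1 = 1 ∧ Q z = w := hwside
  have hnorm : ‖Q z‖ ≤ 1 := mem_closedBall_zero_iff.mp (openEdgeUnion_one_oneEdge_subset (hKω hwK))
  have hd : dist (wideRect z) (Q z) < 1 / 2 := (Quad.dist_apply_le wideRect Q z).trans_lt hdist
  have hre : (wideRect z).re = 2 := by rw [wideRect_re, hz1]; norm_num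
  have h2 : (2 : ℝ) ≤ ‖wideRect z‖ := by
    calc (2 : ℝ) = |(wideRect z).re| := by rw [hre]; norm_num
      _ ≤ ‖wideRect z‖ := Complex.abs_re_le_norm _
  have h3 := norm_sub_norm_le (wideRect z) (Q z)
  rw [← dist_eq_norm] at h3
  linarith

/-- **The dilation `S_2` moves `S₀`**: the action of the dilations on `ℋ_ℂ` is non-trivial. [folklore] -/
theorem dilate_two_S0_ne : QuadConfig.dilate 2 two_ne_zero S0 ≠ S0 := fun h =>
  wideRect_not_mem_S0 (h ▸ wideRect_mem_dilate_two_S0)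

/-- NATURAL STRENGTHENING 1 refuted: configurations are not pointwise dilation invariant. [folklore] -/
theorem not_forall_dilate_eq_self :
    ¬ ∀ (S : QuadConfig (univ : Set ℂ)) (t : ℝ) (ht : 0 < t), QuadConfig.dilate t ht.ne' S = S :=
  fun h => dilate_two_S0_ne (h S0 2 two_pos)

/-- The Dirac law at a configuration. [folklore] -/
def diracLaw (S : QuadConfig (univ : Set ℂ)) : FiniteMeasure (QuadConfig (univ : Set ℂ)) :=
  ⟨Measure.dirac S, inferInstance⟩

/-- `S_t δ_S = δ_{S_t S}`. [folklore] -/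
theorem dilateLaw_diracLaw (t : ℝ) (ht : t ≠ 0) (S : QuadConfig (univ : Set ℂ)) :
    dilateLaw t ht (diracLaw S) = diracLaw (QuadConfig.dilate t ht S) := by
  apply FiniteMeasure.toMeasure_injective
  rw [dilateLaw, FiniteMeasure.toMeasure_map, diracLaw, diracLaw, FiniteMeasure.toMeasure_mk,
    FiniteMeasure.toMeasure_mk, Measure.map_dirac]

/-- The Dirac law at `S₀` is not `S_2`-invariant (test event: `⊞_{wideRect}`). [folklore] -/
theorem dilateLaw_two_diracLaw_S0_ne : dilateLaw 2 two_ne_zero (diracLaw S0) ≠ diracLaw S0 := by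
  intro h
  rw [dilateLaw_diracLaw] at h
  have := congrArg (fun ν : FiniteMeasure (QuadConfig (univ : Set ℂ)) =>
    (ν : Measure (QuadConfig (univ : Set ℂ))) (QuadConfig.crossedEvent wideRect)) h
  simp only [diracLaw, FiniteMeasure.toMeasure_mk,
    Measure.dirac_apply' _ (QuadConfig.measurableSet_crossedEvent _)] at this
  rw [Set.indicator_of_mem (QuadConfig.mem_crossedEvent.mpr wideRect_mem_dilate_two_S0),
    Set.indicator_of_notMem (fun h' => wideRect_not_mem_S0 (QuadConfig.mem_crossedEvent.mp h'))]
    at this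
  exact one_ne_zero this

/-- **`μ ∈ Λ` IS LOAD-BEARING**: the crux with the subsequential-limit hypothesis dropped is false
(witness: the Dirac law at the one-edge configuration, `t = 2`). [folklore] -/
theorem scaleInvariantLimits_false_without_limitHyp : ¬ ScaleInvariantLimitsWithoutLimitHyp :=
  fun h => dilateLaw_two_diracLaw_S0_ne (h (diracLaw S0) 2 two_pos)

/-- NATURAL STRENGTHENING 2 refuted: "every law on `ℋ_ℂ` with total mass one is dilation
invariant" (the Dirac witness is a probability law). [folklore] -/
theorem not_forall_probability_dilateLaw_eq :
    ¬ ∀ μ : FiniteMeasure (QuadConfig (univ : Set ℂ)), μ.mass = 1 →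
      ∀ (t : ℝ) (ht : 0 < t), dilateLaw t ht.ne' μ = μ := by
  intro h
  refine dilateLaw_two_diracLaw_S0_ne (h (diracLaw S0) ?_ 2 two_pos)
  have : ((diracLaw S0).mass : ℝ≥0∞) = 1 := by
    rw [FiniteMeasure.ennreal_mass, diracLaw, FiniteMeasure.toMeasure_mk, measure_univ]
  exact_mod_cast this

/-! ## §3  `t > 0` is NOT load-bearing: the variant over all `t ≠ 0` is equivalent to the crux

`S_{-1}` is the rotation by `π`, the square of the quarter turn, a symmetry of every `δℤ²`; so every
`μ ∈ Λ` is `S_{-1}`-invariant for free (`map_eq_self_of_mem_subseqQuadLimits`), and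
`S_{-t} = S_{-1} S_t`. -/

/-- The crux stated for all non-zero (possibly negative) scale factors. [folklore] -/
def ScaleInvariantLimitsNonzero : Prop :=
  ∀ μ ∈ subseqQuadLimits (univ : Set ℂ), ∀ (t : ℝ) (ht : t ≠ 0), dilateLaw t ht μ = μ

/-- `S_{-1} = R_{π/2} ∘ R_{π/2}` on `ℋ_ℂ`. [folklore] -/
theorem dilate_neg_one_eq :
    (QuadConfig.dilate (-1) (by norm_num) : QuadConfig (univ : Set ℂ) → QuadConfig univ) =
      QuadConfig.rotate (Real.pi / 2) ∘ QuadConfig.rotate (Real.pi / 2) := by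
  have hg : Homeomorph.mulLeft₀ (((-1 : ℝ) : ℂ)) (Complex.ofReal_ne_zero.mpr (by norm_num)) =
      (rotation (Circle.exp (Real.pi / 2))).toHomeomorph.trans
        (rotation (Circle.exp (Real.pi / 2))).toHomeomorph := by
    ext1 z
    rw [Homeomorph.trans_apply, LinearIsometryEquiv.coe_toHomeomorph,
      rotation_exp_pi_div_two_apply, rotation_exp_pi_div_two_apply, Homeomorph.coe_mulLeft₀,
      ← mul_assoc, Complex.I_mul_I]
    push_cast
    ring
  funext S
  simp only [QuadConfig.dilate, Function.comp, QuadConfig.rotate, hg, QuadConfig.mapHomeomorph_trans]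

/-- Every discrete law is `S_{-1}`-invariant (central symmetry of `δℤ²`). [folklore] -/
theorem z2QuadLaw_map_dilate_neg_one (δ : ℝ) :
    (z2QuadLaw univ δ).map (QuadConfig.dilate (-1) (by norm_num)) = z2QuadLaw univ δ := by
  apply FiniteMeasure.toMeasure_injective
  have hr := congrArg (fun ν : FiniteMeasure (QuadConfig (univ : Set ℂ)) =>
    (ν : Measure (QuadConfig (univ : Set ℂ)))) (z2QuadLaw_map_rotate_pi_div_two δ)
  simp only [FiniteMeasure.toMeasure_map] at hr
  rw [FiniteMeasure.toMeasure_map, dilate_neg_one_eq,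
    ← Measure.map_map (QuadConfig.measurable_rotate _) (QuadConfig.measurable_rotate _), hr, hr]

/-- **Free symmetry 3: every subsequential limit is `S_{-1}`-invariant.** [folklore] -/
theorem dilateLaw_neg_one_eq_self {μ : FiniteMeasure (QuadConfig (univ : Set ℂ))}
    (hμ : μ ∈ subseqQuadLimits (univ : Set ℂ)) : dilateLaw (-1) (by norm_num) μ = μ :=
  map_eq_self_of_mem_subseqQuadLimits (continuous_dilate _ _)
    (fun δ _ => z2QuadLaw_map_dilate_neg_one δ) hμ

/-- **`t > 0` is not load-bearing**: the all-`t ≠ 0` variant is EQUIVALENT to the crux. [folklore] -/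
theorem scaleInvariantLimitsNonzero_iff : ScaleInvariantLimitsNonzero ↔ ScaleInvariantLimits := by
  constructor
  · exact fun h μ hμ t ht => h μ hμ t ht.ne'
  · intro h μ hμ t ht
    rcases lt_or_gt_of_ne ht with hlt | hlt
    · have hneg : 0 < -t := neg_pos.mpr hlt
      calc dilateLaw t ht μ
          = dilateLaw ((-1) * (-t)) (mul_ne_zero (by norm_num) hneg.ne') μ :=
            dilateLaw_congr _ _ (by ring) μ
        _ = dilateLaw (-1) (by norm_num) (dilateLaw (-t) hneg.ne' μ) :=
            (dilateLaw_dilateLaw _ _ _ _ μ).symm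
        _ = μ := by rw [h μ hμ (-t) hneg, dilateLaw_neg_one_eq_self hμ]
    · exact h μ hμ t hlt

/-! ## §4  The asymptotic (lattice) form of the crux

The informal gloss "equivalently `d(μ_δ, μ_{λδ}) → 0`" made precise WITHOUT a metric and without
continuity-set lemmas: test against bounded continuous `f : ℋ_ℂ → ℝ`.  `AsymptoticLagInvariance`
says that for every `t > 0`, every positive null sequence of meshes and every such `f`, the lag-`t`
discrepancy `∫ f dμ_δ - ∫ f dμ_{tδ}` tends to `0`.  It is EQUIVALENT to the crux (compactness of
`Λ`'s ambient space + uniqueness of weak limits).  This is the exact shape the route's Russo engine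
must deliver (there with crossing indicators, which needs SS11 §5 continuity sets on top). -/

/-- The lag-`t` discrepancy of the discrete laws tested against `f`. [folklore] -/
def lagGap (t : ℝ) (f : QuadConfig (univ : Set ℂ) →ᵇ ℝ) (δ : ℝ) : ℝ :=
  (∫ S, f S ∂(z2QuadLaw univ δ : Measure (QuadConfig (univ : Set ℂ)))) -
    ∫ S, f S ∂(z2QuadLaw univ (t * δ) : Measure (QuadConfig (univ : Set ℂ)))

/-- Asymptotic lag invariance of the discrete laws against bounded continuous test functions. [folklore] -/
def AsymptoticLagInvariance : Prop :=
  ∀ t : ℝ, 0 < t → ∀ δs : ℕ → ℝ, (∀ k, 0 < δs k) → Tendsto δs atTop (𝓝 0) →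
    ∀ f : QuadConfig (univ : Set ℂ) →ᵇ ℝ, Tendsto (fun k => lagGap t f (δs k)) atTop (𝓝 0)

/-- Along a mesh sequence whose laws converge to `μ`, the lag-`t` discrepancy converges to
`∫ f dμ - ∫ f d(S_t μ)`. [folklore] -/
theorem tendsto_lagGap_of_tendsto {t : ℝ} (ht : 0 < t) {δs : ℕ → ℝ}
    {μ : FiniteMeasure (QuadConfig (univ : Set ℂ))}
    (hlim : Tendsto (fun k => z2QuadLaw univ (δs k)) atTop (𝓝 μ))
    (f : QuadConfig (univ : Set ℂ) →ᵇ ℝ) :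
    Tendsto (fun k => lagGap t f (δs k)) atTop
      (𝓝 ((∫ S, f S ∂(μ : Measure (QuadConfig (univ : Set ℂ)))) -
        ∫ S, f S ∂(dilateLaw t ht.ne' μ : Measure (QuadConfig (univ : Set ℂ))))) := by
  have hc : Tendsto (fun k => dilateLaw t ht.ne' (z2QuadLaw univ (δs k))) atTop
      (𝓝 (dilateLaw t ht.ne' μ)) := ((continuous_dilateLaw t ht.ne').tendsto μ).comp hlim
  have hlim' : Tendsto (fun k => z2QuadLaw univ (t * δs k)) atTop (𝓝 (dilateLaw t ht.ne' μ)) := by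
    simpa only [dilateLaw_z2QuadLaw] using hc
  exact ((FiniteMeasure.tendsto_iff_forall_integral_tendsto.mp hlim) f).sub
    ((FiniteMeasure.tendsto_iff_forall_integral_tendsto.mp hlim') f)

/-- **The crux ⇔ asymptotic lag invariance of the discrete laws.** [folklore] -/
theorem scaleInvariantLimits_iff_asymptotic : ScaleInvariantLimits ↔ AsymptoticLagInvariance := by
  constructor
  · intro hX t ht δs hpos h0 f
    by_contra hnot
    -- a subsequence along which the discrepancy stays `≥ ε`
    obtain ⟨ε, hε, hfreq⟩ : ∃ ε > 0, ∃ᶠ k in atTop, ε ≤ |lagGap t f (δs k)| := by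
      by_contra hall
      push Not at hall
      apply hnot
      rw [Metric.tendsto_nhds]
      intro ε hε
      filter_upwards [hall ε hε] with k hk
      rwa [Real.dist_0_eq_abs]
    obtain ⟨ψ, hψ, hψε⟩ := Filter.extraction_of_frequently_atTop hfreq
    obtain ⟨φ, hφ, μ, hμ, hconv⟩ :=
      Cruxes.LagHandOff.CrosscutDictionary.exists_mem_subseqQuadLimits_tendsto_subseq
        (δs ∘ ψ) (fun n => hpos _) (h0.comp hψ.tendsto_atTop)
    have hgap := tendsto_lagGap_of_tendsto ht hconv f
    rw [hX μ hμ t ht, sub_self, Metric.tendsto_nhds] at hgap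
    obtain ⟨n, hn⟩ := (hgap ε hε).exists
    rw [Real.dist_0_eq_abs] at hn
    exact absurd (hψε (φ n)) (not_le.mpr hn)
  · intro hA μ hμ t ht
    obtain ⟨δs, hpos, h0, hlim⟩ := (isSubseqQuadLimit_iff univ μ).mp hμ
    symm
    apply FiniteMeasure.ext_of_forall_integral_eq
    intro f
    have h1 := tendsto_lagGap_of_tendsto ht hlim f
    have h2 := hA t ht δs hpos h0 f
    have := tendsto_nhds_unique h1 h2
    linarith

/-! ## §5  The natural WEAKENING is true: an `S_2`-invariant law built from the percolation laws

Krylov–Bogolyubov over dyadic scales: the Cesàro averages `ν_n = (n+1)⁻¹ Σ_{j ≤ n} μ_{2^{-(j+1)}}`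
of the discrete laws satisfy `S_2 ν_n − ν_n = (n+1)⁻¹ (μ_1 − μ_{2^{-(n+1)}}) → 0` against every test
function, so every weak subsequential limit of `(ν_n)` (which exists: `ℋ_ℂ` compact metrizable) is an
`S_2`-INVARIANT probability law in the closed convex hull of the percolation laws.  Hence the failure
of the crux, if any, is invisible to every convex (averaged) functional of the laws, and "there is a
dilation-invariant law made of critical bond-`ℤ²` crossing laws" is TRUE — only its location INSIDE
`Λ` (rather than in the closed convex hull of the scaling orbit) is the open content of `X`. -/

/-- Additivity of `testAgainstNN` in the measure. [folklore] -/
theorem add_testAgainstNN_apply {Ω : Type*} [MeasurableSpace Ω] [TopologicalSpace Ω]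
    (μ ν : FiniteMeasure Ω) (f : Ω →ᵇ ℝ≥0) :
    (μ + ν).testAgainstNN f = μ.testAgainstNN f + ν.testAgainstNN f := by
  simp only [← ENNReal.coe_inj, ENNReal.coe_add, FiniteMeasure.testAgainstNN_coe_eq,
    FiniteMeasure.toMeasure_add, lintegral_add_measure]

/-- `testAgainstNN f` of a finite sum of measures. [folklore] -/
theorem sum_testAgainstNN_apply {Ω : Type*} [MeasurableSpace Ω] [TopologicalSpace Ω]
    {ι : Type*} (s : Finset ι) (μ : ι → FiniteMeasure Ω) (f : Ω →ᵇ ℝ≥0) :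
    (∑ i ∈ s, μ i).testAgainstNN f = ∑ i ∈ s, (μ i).testAgainstNN f := by
  classical
  induction s using Finset.induction_on with
  | empty => simp [FiniteMeasure.zero_testAgainstNN_apply]
  | insert a s ha ih => rw [Finset.sum_insert ha, Finset.sum_insert ha, add_testAgainstNN_apply, ih]

/-- The dyadic meshes `2^{-j}`. [folklore] -/
theorem dyadic_pos (j : ℕ) : (0 : ℝ) < (2 : ℝ)⁻¹ ^ j := by positivity

/-- **Dyadic Cesàro averages** of the discrete laws: `ν_n = (n+1)⁻¹ Σ_{j ≤ n} μ_{2^{-(j+1)}}`. [folklore] -/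
def dyadicCesaro (n : ℕ) : FiniteMeasure (QuadConfig (univ : Set ℂ)) :=
  ((n : ℝ≥0) + 1)⁻¹ • ∑ j ∈ Finset.range (n + 1), z2QuadLaw univ ((2 : ℝ)⁻¹ ^ (j + 1))

/-- `S_2 ν_n = (n+1)⁻¹ Σ_{j ≤ n} μ_{2^{-j}}` (dilation shifts the dyadic window by one). [folklore] -/
theorem dilateLaw_two_dyadicCesaro (n : ℕ) :
    dilateLaw 2 two_ne_zero (dyadicCesaro n) =
      ((n : ℝ≥0) + 1)⁻¹ • ∑ j ∈ Finset.range (n + 1), z2QuadLaw univ ((2 : ℝ)⁻¹ ^ j) := by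
  change FiniteMeasure.mapHom (QuadConfig.measurable_dilate 2 two_ne_zero) (dyadicCesaro n) = _
  rw [dyadicCesaro, map_smul, map_sum]
  congr 1
  refine Finset.sum_congr rfl fun j _ => ?_
  change (z2QuadLaw univ ((2 : ℝ)⁻¹ ^ (j + 1))).map (QuadConfig.dilate 2 two_ne_zero) = _
  rw [z2QuadLaw_map_dilate, pow_succ, mul_comm ((2 : ℝ)⁻¹ ^ j), ← mul_assoc,
    mul_inv_cancel₀ (two_ne_zero' ℝ), one_mul]

/-- `ν_n` is a probability law. [folklore] -/
theorem mass_dyadicCesaro (n : ℕ) : (dyadicCesaro n).mass = 1 := by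
  have hsum : (∑ j ∈ Finset.range (n + 1), z2QuadLaw univ ((2 : ℝ)⁻¹ ^ (j + 1))).mass
      = (n : ℝ≥0) + 1 := by
    have : ∀ j, (z2QuadLaw univ ((2 : ℝ)⁻¹ ^ (j + 1))).mass = 1 :=
      fun j => mass_z2QuadLaw isOpen_univ (dyadic_pos _)
    simp only [FiniteMeasure.mass, FiniteMeasure.coeFn_def, FiniteMeasure.toMeasure_sum,
      Measure.coe_finsetSum, Finset.sum_apply] at this ⊢
    rw [ENNReal.toNNReal_sum (fun j _ => measure_ne_top _ _)]
    simp only [this, Finset.sum_const, Finset.card_range, nsmul_eq_mul, mul_one]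
    push_cast; ring
  rw [dyadicCesaro, FiniteMeasure.mass, FiniteMeasure.smul_apply, smul_eq_mul]
  change ((n : ℝ≥0) + 1)⁻¹ * (∑ j ∈ Finset.range (n + 1), z2QuadLaw univ ((2 : ℝ)⁻¹ ^ (j + 1))).mass = 1
  rw [hsum, inv_mul_cancel₀]
  exact ne_of_gt (by positivity)

/-- The telescoping estimate: against every test function, `S_2 ν_n` and `ν_n` differ by at most
`‖f‖ / (n+1)`. [folklore] -/
theorem abs_testAgainstNN_dilateLaw_two_dyadicCesaro_sub_le (n : ℕ)
    (f : QuadConfig (univ : Set ℂ) →ᵇ ℝ≥0) :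
    |((dilateLaw 2 two_ne_zero (dyadicCesaro n)).testAgainstNN f : ℝ) -
        ((dyadicCesaro n).testAgainstNN f : ℝ)| ≤ (nndist f 0 : ℝ) / ((n : ℝ) + 1) := by
  set b : ℕ → ℝ := fun j => ((z2QuadLaw univ ((2 : ℝ)⁻¹ ^ j)).testAgainstNN f : ℝ) with hb
  have hb_nonneg : ∀ j, 0 ≤ b j := fun j => NNReal.coe_nonneg _
  have hb_le : ∀ j, b j ≤ (nndist f 0 : ℝ) := fun j => by
    have h := (z2QuadLaw univ ((2 : ℝ)⁻¹ ^ j)).testAgainstNN_lipschitz_estimate f 0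
    rw [FiniteMeasure.testAgainstNN_zero, zero_add, mass_z2QuadLaw isOpen_univ (dyadic_pos _),
      mul_one] at h
    exact_mod_cast h
  have h1 : ((dilateLaw 2 two_ne_zero (dyadicCesaro n)).testAgainstNN f : ℝ) =
      ((n : ℝ) + 1)⁻¹ * ∑ j ∈ Finset.range (n + 1), b j := by
    rw [dilateLaw_two_dyadicCesaro, FiniteMeasure.smul_testAgainstNN_apply, sum_testAgainstNN_apply]
    simp [hb]
  have h2 : ((dyadicCesaro n).testAgainstNN f : ℝ) =
      ((n : ℝ) + 1)⁻¹ * ∑ j ∈ Finset.range (n + 1), b (j + 1) := by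
    rw [dyadicCesaro, FiniteMeasure.smul_testAgainstNN_apply, sum_testAgainstNN_apply]
    simp [hb]
  have htel : ∑ j ∈ Finset.range (n + 1), b j - ∑ j ∈ Finset.range (n + 1), b (j + 1) =
      b 0 - b (n + 1) := by
    rw [Finset.sum_range_succ', Finset.sum_range_succ]
    ring
  have hpos : (0 : ℝ) < (n : ℝ) + 1 := by positivity
  rw [h1, h2, ← mul_sub, htel, abs_mul, abs_of_pos (inv_pos.mpr hpos), div_eq_inv_mul]
  refine mul_le_mul_of_nonneg_left ?_ (inv_pos.mpr hpos).le
  rw [abs_le]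
  constructor <;> linarith [hb_nonneg 0, hb_le 0, hb_nonneg (n + 1), hb_le (n + 1)]

/-- **An `S_2`-invariant probability law made of percolation laws exists**: some subsequence of the
dyadic Cesàro averages converges weakly, and every such limit is `S_2`-invariant (and a probability
law).  The natural weakening of the crux — existence of a dilation-invariant law in the closed convex
hull of the scaling orbit `{μ_δ}` — is therefore TRUE; what `X` asserts beyond it is that the
invariant laws exhaust `Λ` itself. [folklore] -/
theorem exists_dilateLaw_two_invariant_cesaroLimit :
    ∃ ν : FiniteMeasure (QuadConfig (univ : Set ℂ)), ν.mass = 1 ∧ dilateLaw 2 two_ne_zero ν = ν ∧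
      ∃ φ : ℕ → ℕ, StrictMono φ ∧ Tendsto (fun k => dyadicCesaro (φ k)) atTop (𝓝 ν) := by
  haveI : TopologicalSpace.SeparableSpace (QuadConfig (univ : Set ℂ)) := by
    letI := TopologicalSpace.metrizableSpaceMetric (QuadConfig (univ : Set ℂ))
    infer_instance
  have hprob : ∀ n, IsProbabilityMeasure (dyadicCesaro n : Measure (QuadConfig (univ : Set ℂ))) :=
    fun n => ⟨by rw [← FiniteMeasure.ennreal_mass, mass_dyadicCesaro, ENNReal.coe_one]⟩
  let π : ℕ → ProbabilityMeasure (QuadConfig (univ : Set ℂ)) := fun n =>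
    ⟨(dyadicCesaro n : Measure (QuadConfig (univ : Set ℂ))), hprob n⟩
  have hπF : ∀ n, (π n).toFiniteMeasure = dyadicCesaro n := fun n => rfl
  obtain ⟨πlim, -, φ, hφ, hlimπ⟩ := isCompact_univ.tendsto_subseq (x := π) fun n => mem_univ _
  have hconv : Tendsto (fun k => dyadicCesaro (φ k)) atTop (𝓝 πlim.toFiniteMeasure) := by
    have := (ProbabilityMeasure.tendsto_nhds_iff_toFiniteMeasure_tendsto_nhds _).1 hlimπ
    simpa only [Function.comp_def, hπF] using this
  set ν := πlim.toFiniteMeasure with hν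
  refine ⟨ν, ?_, ?_, φ, hφ, hconv⟩
  · have : (ν.mass : ℝ≥0∞) = 1 := by
      rw [FiniteMeasure.ennreal_mass, hν]
      change (πlim : Measure (QuadConfig (univ : Set ℂ))) univ = 1
      exact measure_univ
    exact_mod_cast this
  · -- test functions: both `S_2 ν_{φ k}` and `ν_{φ k}` converge, and their difference tends to `0`
    apply FiniteMeasure.ext_of_forall_lintegral_eq
    intro f
    have hA : Tendsto (fun k => ((dilateLaw 2 two_ne_zero (dyadicCesaro (φ k))).testAgainstNN f : ℝ))
        atTop (𝓝 ((dilateLaw 2 two_ne_zero ν).testAgainstNN f : ℝ)) := by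
      have hc : Tendsto (fun k => dilateLaw 2 two_ne_zero (dyadicCesaro (φ k))) atTop
          (𝓝 (dilateLaw 2 two_ne_zero ν)) :=
        ((FiniteMeasure.continuous_map (QuadConfig.continuous_mapHomeomorph _)).tendsto ν).comp hconv
      exact NNReal.continuous_coe.continuousAt.tendsto.comp
        ((FiniteMeasure.tendsto_iff_forall_testAgainstNN_tendsto.mp hc) f)
    have hB : Tendsto (fun k => ((dyadicCesaro (φ k)).testAgainstNN f : ℝ)) atTop
        (𝓝 (ν.testAgainstNN f : ℝ)) :=
      NNReal.continuous_coe.continuousAt.tendsto.comp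
        ((FiniteMeasure.tendsto_iff_forall_testAgainstNN_tendsto.mp hconv) f)
    have hD : Tendsto (fun k => ((dilateLaw 2 two_ne_zero (dyadicCesaro (φ k))).testAgainstNN f : ℝ)
        - ((dyadicCesaro (φ k)).testAgainstNN f : ℝ)) atTop (𝓝 0) := by
      have hbound : Tendsto (fun k => (nndist f 0 : ℝ) / ((φ k : ℝ) + 1)) atTop (𝓝 0) := by
        have h1 : Tendsto (fun k => ((φ k : ℝ) + 1)) atTop atTop := by
          have : Tendsto (fun k => (φ k : ℝ)) atTop atTop :=
            tendsto_natCast_atTop_atTop.comp hφ.tendsto_atTop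
          exact this.atTop_add tendsto_const_nhds
        exact tendsto_const_nhds.div_atTop h1
      exact squeeze_zero_norm (fun k => abs_testAgainstNN_dilateLaw_two_dyadicCesaro_sub_le _ f) hbound
    have hEq : ((dilateLaw 2 two_ne_zero ν).testAgainstNN f : ℝ) = (ν.testAgainstNN f : ℝ) := by
      have := tendsto_nhds_unique (hA.sub hB) hD
      linarith
    have hEq' : (dilateLaw 2 two_ne_zero ν).testAgainstNN f = ν.testAgainstNN f := by exact_mod_cast hEq
    rw [← FiniteMeasure.testAgainstNN_coe_eq, ← FiniteMeasure.testAgainstNN_coe_eq, hEq']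

/-! ## §6  Free symmetry 4: every subsequential limit is invariant under ALL translations of the plane

Lattice translations are free by the transfer principle (`z2QuadLaw_map_translate_meshPoint`); the
passage `δₖℤ² → ℂ` needs the JOINT continuity of the action `(v, S) ↦ v + S` of `ℂ` on `ℋ_ℂ`
(`continuous_translate₂`, checked on the subbase with the `(esb)` approximation of SS11 §3), whence
uniform continuity of `v ↦ f ∘ T_v` for every test function (`ℋ_ℂ` compact).  So of the similarity
group only the ROTATIONS (DKKMO, `RotationInput`) and the DILATIONS (the crux) are not free. -/

/-- Translating a quad moves it by at most `‖w‖` in the uniform metric. [folklore] -/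
theorem dist_mapHomeomorph_addLeft_le (Q : Quad (univ : Set ℂ)) (w : ℂ) :
    dist (Q.mapHomeomorph (Homeomorph.addLeft w)) Q ≤ ‖w‖ := by
  rw [Quad.dist_eq, ContinuousMap.dist_le (norm_nonneg w)]
  intro z
  simp [dist_eq_norm]

/-- `T_0 = id`. [folklore] -/
theorem translate_zero (S : QuadConfig (univ : Set ℂ)) : QuadConfig.translate 0 S = S := by
  have h : Homeomorph.addLeft (0 : ℂ) = Homeomorph.refl ℂ := by ext z; simp
  rw [QuadConfig.translate, h, QuadConfig.mapHomeomorph_refl]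

/-- `T_{v + w} = T_v ∘ T_w`. [folklore] -/
theorem translate_add (v w : ℂ) (S : QuadConfig (univ : Set ℂ)) :
    QuadConfig.translate (v + w) S = QuadConfig.translate v (QuadConfig.translate w S) := by
  have h : Homeomorph.addLeft (v + w) = (Homeomorph.addLeft w).trans (Homeomorph.addLeft v) := by
    ext z; simp [add_assoc]
  rw [QuadConfig.translate, QuadConfig.translate, QuadConfig.translate, h,
    QuadConfig.mapHomeomorph_trans]

/-- Joint continuity of the translation action at `(0, S₀)`, checked on the subbase `V_U`, `V^Q`
(the `V^Q` case uses the `(esb)` approximation `Q' < Q`, `Q' ∉ S₀`). [folklore] -/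
theorem tendsto_translate_nhds_zero (S₀ : QuadConfig (univ : Set ℂ)) :
    Tendsto (fun p : ℂ × QuadConfig (univ : Set ℂ) => QuadConfig.translate p.1 p.2)
      (𝓝 (0 : ℂ) ×ˢ 𝓝 S₀) (𝓝 S₀) := by
  nth_rw 2 [TopologicalSpace.nhds_generateFrom]
  simp only [tendsto_iInf, tendsto_principal]
  rintro V ⟨hSV, hV⟩
  rcases hV with ⟨U, hU, rfl⟩ | ⟨Q, rfl⟩
  · obtain ⟨Q, hQS, hQU⟩ := hSV
    obtain ⟨r, hr, hball⟩ := Metric.isOpen_iff.mp hU Q hQU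
    have h1 : ∀ᶠ p : ℂ × QuadConfig (univ : Set ℂ) in 𝓝 (0 : ℂ) ×ˢ 𝓝 S₀,
        dist p.1 0 < r / 2 ∧ p.2 ∈ QuadConfig.someCrossed (Metric.ball Q (r / 2)) :=
      Filter.Eventually.prod_mk ((Metric.tendsto_nhds.mp tendsto_id) (r / 2) (half_pos hr))
        ((QuadConfig.isOpen_someCrossed Metric.isOpen_ball).mem_nhds
          ⟨Q, hQS, Metric.mem_ball_self (half_pos hr)⟩)
    filter_upwards [h1] with p ⟨hp1, hp2⟩
    obtain ⟨Q', hQ'S, hQ'⟩ := hp2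
    refine ⟨Q'.mapHomeomorph (Homeomorph.addLeft p.1), ?_, ?_⟩
    · show Q'.mapHomeomorph (Homeomorph.addLeft p.1) ∈ QuadConfig.translate p.1 p.2
      rw [QuadConfig.translate, QuadConfig.mem_mapHomeomorph, Quad.mapHomeomorph_symm_mapHomeomorph]
      exact hQ'S
    · apply hball
      rw [Metric.mem_ball] at hQ' ⊢
      rw [dist_zero_right] at hp1
      calc dist (Q'.mapHomeomorph (Homeomorph.addLeft p.1)) Q
          ≤ dist (Q'.mapHomeomorph (Homeomorph.addLeft p.1)) Q' + dist Q' Q := dist_triangle _ _ _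
        _ < r / 2 + r / 2 := add_lt_add_of_le_of_lt
            ((dist_mapHomeomorph_addLeft_le Q' p.1).trans hp1.le) hQ'
        _ = r := by ring
  · have hQS : Q ∉ S₀ := hSV
    obtain ⟨Q', -, hQ'Q, hQ'S⟩ := QuadConfig.exists_strictlyDominated_notMem_of_esb
      (Quad.mem_closure_setOf_strictlyDominated isOpen_univ) hQS isOpen_univ (mem_univ Q)
    obtain ⟨r, hr, hball⟩ :=
      Metric.isOpen_iff.mp (Quad.isOpen_setOf_strictlyDominated_right Q') Q hQ'Q
    have h1 : ∀ᶠ p : ℂ × QuadConfig (univ : Set ℂ) in 𝓝 (0 : ℂ) ×ˢ 𝓝 S₀,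
        dist p.1 0 < r ∧ p.2 ∈ QuadConfig.notCrossed Q' :=
      Filter.Eventually.prod_mk ((Metric.tendsto_nhds.mp tendsto_id) r hr)
        ((QuadConfig.isOpen_notCrossed Q').mem_nhds hQ'S)
    filter_upwards [h1] with p ⟨hp1, hp2⟩
    intro hQ
    change Q ∈ QuadConfig.translate p.1 p.2 at hQ
    rw [QuadConfig.translate, QuadConfig.mem_mapHomeomorph] at hQ
    have hlt : Quad.StrictlyDominated Q' (Q.mapHomeomorph (Homeomorph.addLeft p.1).symm) := by
      apply hball
      rw [Metric.mem_ball, Homeomorph.addLeft_symm]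
      rw [dist_zero_right] at hp1
      exact (dist_mapHomeomorph_addLeft_le Q (-p.1)).trans_lt (by rwa [norm_neg])
    exact hp2 (p.2.isLowerQuadSet hQ hlt)

/-- **The action `(v, S) ↦ v + S` of `ℂ` on `ℋ_ℂ` is jointly continuous.** [folklore] -/
theorem continuous_translate₂ :
    Continuous (fun p : ℂ × QuadConfig (univ : Set ℂ) => QuadConfig.translate p.1 p.2) := by
  refine continuous_iff_continuousAt.mpr fun q => ?_
  obtain ⟨w₀, S₀⟩ := q
  have key : (fun p : ℂ × QuadConfig (univ : Set ℂ) => QuadConfig.translate p.1 p.2) =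
      fun p => QuadConfig.translate (p.1 - w₀) (QuadConfig.translate w₀ p.2) := by
    funext p
    rw [← translate_add, sub_add_cancel]
  have h2 : Tendsto (fun p : ℂ × QuadConfig (univ : Set ℂ) => (p.1 - w₀, QuadConfig.translate w₀ p.2))
      (𝓝 (w₀, S₀)) (𝓝 (0 : ℂ) ×ˢ 𝓝 (QuadConfig.translate w₀ S₀)) := by
    rw [← nhds_prod_eq]
    have hc : Continuous (fun p : ℂ × QuadConfig (univ : Set ℂ) =>
        (p.1 - w₀, QuadConfig.translate w₀ p.2)) :=
      (continuous_fst.sub continuous_const).prodMk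
        ((QuadConfig.continuous_mapHomeomorph _).comp continuous_snd)
    simpa using hc.tendsto (w₀, S₀)
  rw [ContinuousAt, key]
  simpa [Function.comp_def, translate_zero] using
    (tendsto_translate_nhds_zero (QuadConfig.translate w₀ S₀)).comp h2

/-- Uniform continuity of `v ↦ f ∘ T_v` at `0` along a null sequence, for a test function `f`
(compactness of `ℋ_ℂ` + joint continuity, via currying in the compact-open topology). [folklore] -/
theorem tendstoUniformly_comp_translate (f : QuadConfig (univ : Set ℂ) →ᵇ ℝ) {u : ℕ → ℂ}
    (hu : Tendsto u atTop (𝓝 0)) :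
    TendstoUniformly (fun k S => f (QuadConfig.translate (u k) S)) (fun S => f S) atTop := by
  let G : C(ℂ × QuadConfig (univ : Set ℂ), ℝ) :=
    ⟨fun p => f (QuadConfig.translate p.1 p.2), f.continuous.comp continuous_translate₂⟩
  have hG : Tendsto (fun k => G.curry (u k)) atTop (𝓝 (G.curry 0)) :=
    (G.curry.continuous.tendsto 0).comp hu
  rw [ContinuousMap.tendsto_iff_tendstoUniformly] at hG
  have h0 : (⇑(G.curry 0) : QuadConfig (univ : Set ℂ) → ℝ) = fun S => f S := by
    funext S
    change f (QuadConfig.translate 0 S) = f S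
    rw [translate_zero]
  rw [h0] at hG
  exact hG

/-- Lattice approximants of a vector: `δ [v/δ] → v` as `δ → 0⁺`. [folklore] -/
theorem tendsto_meshPoint_nearestSite {δs : ℕ → ℝ} (hpos : ∀ k, 0 < δs k)
    (h0 : Tendsto δs atTop (𝓝 0)) (v : ℂ) :
    Tendsto (fun k => meshPoint (δs k) (nearestSite (δs k) v)) atTop (𝓝 v) := by
  rw [Metric.tendsto_nhds]
  intro ε hε
  have := (Metric.tendsto_nhds.mp h0) ε hε
  filter_upwards [this] with k hk
  rw [Real.dist_0_eq_abs, abs_of_pos (hpos k)] at hk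
  exact (dist_meshPoint_nearestSite_le (hpos k) v).trans_lt hk

/-- **Free symmetry 4: every subsequential limit is invariant under every translation of the plane.**
Proof: `T_v μ_δ = T_{v - v_δ} μ_δ` for the lattice vector `v_δ = δ[v/δ]` (exact invariance), and
`∫ f ∘ T_u dμ_δ − ∫ f dμ_δ → 0` as `u = v − v_δ → 0` uniformly in `δ` (uniform continuity of the
action against test functions); pass to the limit and compare test integrals. [folklore] -/
theorem map_translate_eq_self_of_mem_subseqQuadLimits (v : ℂ)
    {μ : FiniteMeasure (QuadConfig (univ : Set ℂ))} (hμ : μ ∈ subseqQuadLimits (univ : Set ℂ)) :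
    μ.map (QuadConfig.translate v) = μ := by
  obtain ⟨δs, hpos, h0, hlim⟩ := (isSubseqQuadLimit_iff univ μ).mp hμ
  set vk : ℕ → ℂ := fun k => meshPoint (δs k) (nearestSite (δs k) v) with hvk_def
  set u : ℕ → ℂ := fun k => v - vk k with hu_def
  have hu : Tendsto u atTop (𝓝 0) := by
    have := (tendsto_const_nhds (x := v)).sub (tendsto_meshPoint_nearestSite hpos h0 v)
    rwa [sub_self] at this
  -- exact lattice invariance and the splitting `T_v = T_{u k} ∘ T_{vk k}`
  have hsplit : ∀ k, (z2QuadLaw univ (δs k)).map (QuadConfig.translate v) =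
      (z2QuadLaw univ (δs k)).map (QuadConfig.translate (u k)) := by
    intro k
    have hfun : (QuadConfig.translate v : QuadConfig (univ : Set ℂ) → _) =
        QuadConfig.translate (u k) ∘ QuadConfig.translate (vk k) := by
      funext S; change _ = QuadConfig.translate (u k) (QuadConfig.translate (vk k) S)
      rw [← translate_add, hu_def]; simp
    apply FiniteMeasure.toMeasure_injective
    rw [FiniteMeasure.toMeasure_map, FiniteMeasure.toMeasure_map, hfun,
      ← Measure.map_map (QuadConfig.measurable_translate _) (QuadConfig.measurable_translate _)]
    have hinv := congrArg (fun ν : FiniteMeasure (QuadConfig (univ : Set ℂ)) =>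
      (ν : Measure (QuadConfig (univ : Set ℂ)))) (z2QuadLaw_map_translate_meshPoint (δs k)
        (nearestSite (δs k) v))
    simp only [FiniteMeasure.toMeasure_map] at hinv
    rw [hinv]
  -- compare test integrals
  apply FiniteMeasure.ext_of_forall_integral_eq
  intro f
  have hA : Tendsto (fun k => ∫ S, f S ∂((z2QuadLaw univ (δs k)).map (QuadConfig.translate v) :
      Measure (QuadConfig (univ : Set ℂ)))) atTop
      (𝓝 (∫ S, f S ∂(μ.map (QuadConfig.translate v) : Measure (QuadConfig (univ : Set ℂ))))) := by
    have hc : Tendsto (fun k => (z2QuadLaw univ (δs k)).map (QuadConfig.translate v)) atTop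
        (𝓝 (μ.map (QuadConfig.translate v))) :=
      ((FiniteMeasure.continuous_map (QuadConfig.continuous_mapHomeomorph _)).tendsto μ).comp hlim
    exact (FiniteMeasure.tendsto_iff_forall_integral_tendsto.mp hc) f
  have hB : Tendsto (fun k => ∫ S, f S ∂(z2QuadLaw univ (δs k) : Measure (QuadConfig (univ : Set ℂ))))
      atTop (𝓝 (∫ S, f S ∂(μ : Measure (QuadConfig (univ : Set ℂ))))) :=
    (FiniteMeasure.tendsto_iff_forall_integral_tendsto.mp hlim) f
  have hD : Tendsto (fun k => (∫ S, f S ∂((z2QuadLaw univ (δs k)).map (QuadConfig.translate v) :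
      Measure (QuadConfig (univ : Set ℂ)))) -
        ∫ S, f S ∂(z2QuadLaw univ (δs k) : Measure (QuadConfig (univ : Set ℂ)))) atTop (𝓝 0) := by
    have hunif := tendstoUniformly_comp_translate f hu
    rw [Metric.tendstoUniformly_iff] at hunif
    rw [Metric.tendsto_nhds]
    intro ε hε
    filter_upwards [hunif (ε / 2) (half_pos hε)] with k hk
    haveI : IsProbabilityMeasure (z2QuadLaw univ (δs k) : Measure (QuadConfig (univ : Set ℂ))) :=
      isProbabilityMeasure_z2QuadLaw_of_pos isOpen_univ (hpos k)
    set g : QuadConfig (univ : Set ℂ) →ᵇ ℝ :=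
      f.compContinuous ⟨QuadConfig.translate (u k), QuadConfig.continuous_mapHomeomorph _⟩ with hg
    have hint : ∫ S, f S ∂((z2QuadLaw univ (δs k)).map (QuadConfig.translate v) :
        Measure (QuadConfig (univ : Set ℂ))) =
        ∫ S, g S ∂(z2QuadLaw univ (δs k) : Measure (QuadConfig (univ : Set ℂ))) := by
      rw [hsplit k, FiniteMeasure.toMeasure_map,
        integral_map (QuadConfig.measurable_translate _).aemeasurable
          f.continuous.aestronglyMeasurable]
      rfl
    rw [hint, ← integral_sub (g.integrable _) (f.integrable _), Real.dist_0_eq_abs]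
    have hbound : ∀ S, ‖g S - f S‖ ≤ ε / 2 := fun S => by
      rw [← dist_eq_norm, dist_comm]; exact (hk S).le
    calc |∫ S, (g S - f S) ∂(z2QuadLaw univ (δs k) : Measure (QuadConfig (univ : Set ℂ)))|
        ≤ ε / 2 * (z2QuadLaw univ (δs k) : Measure (QuadConfig (univ : Set ℂ))).real univ := by
          simpa only [Real.norm_eq_abs] using norm_integral_le_of_norm_le_const (ae_of_all _ hbound)
      _ = ε / 2 := by rw [probReal_univ, mul_one]
      _ < ε := half_lt_self hε
  have := tendsto_nhds_unique (hA.sub hB) hD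
  linarith

/-! ## §7  An abstract LIMIT-CYCLE law on `ℋ_ℂ`: rotation invariant, `S_2`-invariant, NOT `S_3`-invariant

The item's "why it might fail" says that rotation invariance (DKKMO) and one lag do not exclude an RG
limit cycle.  Made a theorem at the level of single laws on `ℋ_ℂ`: the Dirac law at the configuration
`S⋆` of quads crossed inside the DYADIC CIRCLES `E⋆ = {‖z‖ = 2ⁿ, n ∈ ℤ}` is invariant under every
rotation and under `S_2` (`2E⋆ = E⋆`) but not under `S_3` (`3E⋆` misses the annulus `0.85 < |z| < 1.25`
around the unit circle, inside which the thin quad `[-1/10, 1/10] × [9/10, 11/10]` is crossed by the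
unit circle).  Consequences: the stabiliser of a law can be the proper closed subgroup `2^ℤ`;
`RotationInput`-type symmetry plus ONE lag cannot replace the second lag in `TwoLagsAllLags`
(`not_allLags_of_rotation_and_lagTwo`); and rotation invariance alone implies no dilation invariance
(`not_dilationInvariant_of_rotationInvariant`).  (The witness is not translation invariant; a
translation-invariant limit cycle needs a randomised construction, e.g. a Poisson field of dyadic
circle patterns — not attempted.) -/

/-- The configuration "quads having a crossing inside the closed set `E`", closed up in `𝒬_ℂ`
(the generic form of Schramm–Smirnov's `S_ω`). [folklore] -/
def crossConfig (E : Set ℂ) : QuadConfig (univ : Set ℂ) :=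
  QuadConfig.ofDominatedLower {Q | ∃ K, Q.IsCrossing K ∧ K ⊆ E}
    (by
      rintro Q ⟨K, hK, hKE⟩ Q' hdom
      obtain ⟨K', hK'K, hK'⟩ := hdom K hK
      exact ⟨K', hK', hK'K.trans hKE⟩)

/-- `coe_crossConfig`: as a set of quads. [folklore] -/
theorem coe_crossConfig (E : Set ℂ) :
    (crossConfig E : Set (Quad (univ : Set ℂ))) = closure {Q | ∃ K, Q.IsCrossing K ∧ K ⊆ E} := rfl

/-- A quad with a crossing inside `E` belongs to `crossConfig E`. [folklore] -/
theorem mem_crossConfig_of_isCrossing {E : Set ℂ} {Q : Quad (univ : Set ℂ)} {K : Set ℂ}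
    (hK : Q.IsCrossing K) (hKE : K ⊆ E) : Q ∈ crossConfig E := by
  rw [← QuadConfig.mem_coe, coe_crossConfig]
  exact subset_closure ⟨K, hK, hKE⟩

/-- **Transport**: `g · crossConfig E = crossConfig (g E)` for a plane homeomorphism `g`. [folklore] -/
theorem mapHomeomorph_crossConfig (g : ℂ ≃ₜ ℂ) (E : Set ℂ) :
    (crossConfig E).mapHomeomorph g = crossConfig (g '' E) := by
  apply SetLike.coe_injective
  rw [QuadConfig.coe_mapHomeomorph, coe_crossConfig, coe_crossConfig, Homeomorph.image_closure,
    setOf_exists_isCrossing_subset_image]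

/-- The dyadic circles `E⋆ = {z : ‖z‖ = 2ⁿ for some n ∈ ℤ}`. [folklore] -/
def dyadicCircles : Set ℂ := {z | ∃ n : ℤ, ‖z‖ = (2 : ℝ) ^ n}

/-- `2 E⋆ = E⋆`. [folklore] -/
theorem image_two_mul_dyadicCircles :
    (fun z : ℂ => (2 : ℂ) * z) '' dyadicCircles = dyadicCircles := by
  ext w
  simp only [mem_image, dyadicCircles, mem_setOf_eq]
  constructor
  · rintro ⟨z, ⟨n, hn⟩, rfl⟩
    refine ⟨n + 1, ?_⟩
    rw [norm_mul, hn, zpow_add_one₀ (two_ne_zero)]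
    simp [mul_comm]
  · rintro ⟨n, hn⟩
    refine ⟨2⁻¹ * w, ⟨n - 1, ?_⟩, by simp⟩
    rw [norm_mul, hn, zpow_sub_one₀ (two_ne_zero)]
    simp [mul_comm]

/-- `e^{iα} E⋆ = E⋆`. [folklore] -/
theorem image_rotation_dyadicCircles (a : Circle) :
    (rotation a : ℂ → ℂ) '' dyadicCircles = dyadicCircles := by
  ext w
  simp only [mem_image, dyadicCircles, mem_setOf_eq]
  constructor
  · rintro ⟨z, ⟨n, hn⟩, rfl⟩
    exact ⟨n, by rw [LinearIsometryEquiv.norm_map, hn]⟩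
  · rintro ⟨n, hn⟩
    refine ⟨(rotation a).symm w, ⟨n, by rw [LinearIsometryEquiv.norm_map, hn]⟩, ?_⟩
    simp

/-- `3 E⋆ = {‖z‖ = 3·2ⁿ}`. [folklore] -/
theorem image_three_mul_dyadicCircles :
    (fun z : ℂ => (3 : ℂ) * z) '' dyadicCircles = {z | ∃ n : ℤ, ‖z‖ = 3 * (2 : ℝ) ^ n} := by
  ext w
  simp only [mem_image, dyadicCircles, mem_setOf_eq]
  constructor
  · rintro ⟨z, ⟨n, hn⟩, rfl⟩
    exact ⟨n, by rw [norm_mul, hn]; simp⟩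
  · rintro ⟨n, hn⟩
    refine ⟨3⁻¹ * w, ⟨n, ?_⟩, ?_⟩
    · rw [norm_mul, hn]; simp
    · simp

/-- No tripled dyadic radius lies in the annulus `(17/20, 5/4)`. [folklore] -/
theorem not_mem_annulus_three_mul_zpow (n : ℤ) :
    ¬ ((17 / 20 : ℝ) < 3 * (2 : ℝ) ^ n ∧ 3 * (2 : ℝ) ^ n < 5 / 4) := by
  rintro ⟨h1, h2⟩
  rcases le_or_gt n (-2) with hn | hn
  · have h3 : (2 : ℝ) ^ n ≤ (2 : ℝ) ^ (-2 : ℤ) := zpow_le_zpow_right₀ (by norm_num) hn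
    have h4 : (2 : ℝ) ^ (-2 : ℤ) = 1 / 4 := by norm_num
    have h5 : 3 * (2 : ℝ) ^ n ≤ 3 * (1 / 4) := by
      rw [← h4]; exact mul_le_mul_of_nonneg_left h3 (by norm_num)
    linarith
  · have hn' : (-1 : ℤ) ≤ n := by omega
    have h3 : (2 : ℝ) ^ (-1 : ℤ) ≤ (2 : ℝ) ^ n := zpow_le_zpow_right₀ (by norm_num) hn'
    have h4 : (2 : ℝ) ^ (-1 : ℤ) = 1 / 2 := by norm_num
    have h5 : 3 * (1 / 2) ≤ 3 * (2 : ℝ) ^ n := by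
      rw [← h4]; exact mul_le_mul_of_nonneg_left h3 (by norm_num)
    linarith

/-- The limit-cycle configuration `S⋆ = crossConfig E⋆`. [folklore] -/
def Sstar : QuadConfig (univ : Set ℂ) := crossConfig dyadicCircles

/-- `S⋆` is invariant under every rotation. [folklore] -/
theorem rotate_Sstar (α : ℝ) : QuadConfig.rotate α Sstar = Sstar := by
  rw [QuadConfig.rotate, Sstar, mapHomeomorph_crossConfig]
  congr 1
  rw [LinearIsometryEquiv.coe_toHomeomorph]
  exact image_rotation_dyadicCircles _

/-- `S⋆` is `S_2`-invariant. [folklore] -/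
theorem dilate_two_Sstar : QuadConfig.dilate 2 two_ne_zero Sstar = Sstar := by
  rw [QuadConfig.dilate, Sstar, mapHomeomorph_crossConfig]
  congr 1
  rw [Homeomorph.coe_mulLeft₀]
  push_cast
  exact image_two_mul_dyadicCircles

/-- `S_3 S⋆ = crossConfig (3E⋆)`. [folklore] -/
theorem dilate_three_Sstar :
    QuadConfig.dilate 3 three_ne_zero Sstar = crossConfig {z | ∃ n : ℤ, ‖z‖ = 3 * (2 : ℝ) ^ n} := by
  rw [QuadConfig.dilate, Sstar, mapHomeomorph_crossConfig]
  congr 1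
  rw [Homeomorph.coe_mulLeft₀]
  push_cast
  exact image_three_mul_dyadicCircles

/-- The test quad: the thin rectangle `[-1/10, 1/10] × [9/10, 11/10]`,
`(a, b) ↦ (-1/10 + a/5) + (9/10 + b/5) i`, sides `0`/`2` vertical. [folklore] -/
def thinQuad : Quad (univ : Set ℂ) where
  toFun p := ((-1 / 10 + (p.1 : ℝ) / 5 : ℝ) : ℂ) + ((9 / 10 + (p.2 : ℝ) / 5 : ℝ) : ℂ) * Complex.I
  continuous_toFun := by fun_prop
  injective_toFun := by
    rintro ⟨s, t⟩ ⟨s', t'⟩ h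
    obtain ⟨h1, h2⟩ := Quad.ofReal_add_ofReal_mul_I_inj h
    refine Prod.ext (Subtype.ext ?_) (Subtype.ext ?_)
    · linarith
    · linarith
  range_subset := subset_univ _

/-- `thinQuad (a, b) = (-1/10 + a/5) + (9/10 + b/5) i`. [folklore] -/
theorem thinQuad_apply (p : unitInterval × unitInterval) :
    thinQuad p = ((-1 / 10 + (p.1 : ℝ) / 5 : ℝ) : ℂ) + ((9 / 10 + (p.2 : ℝ) / 5 : ℝ) : ℂ) * Complex.I :=
  rfl

/-- Real and imaginary parts of `thinQuad`. [folklore] -/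
theorem thinQuad_re_im (p : unitInterval × unitInterval) :
    (thinQuad p).re = -1 / 10 + (p.1 : ℝ) / 5 ∧ (thinQuad p).im = 9 / 10 + (p.2 : ℝ) / 5 :=
  Quad.re_im_ofReal_add_ofReal_mul_I _ _

/-- Points of `thinQuad` have norm in `[9/10, 6/5]`. [folklore] -/
theorem norm_thinQuad_mem (p : unitInterval × unitInterval) :
    (9 / 10 : ℝ) ≤ ‖thinQuad p‖ ∧ ‖thinQuad p‖ ≤ 6 / 5 := by
  obtain ⟨hre, him⟩ := thinQuad_re_im p
  have ha := p.1.2; have hb := p.2.2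
  simp only [mem_Icc] at ha hb
  constructor
  · calc (9 / 10 : ℝ) ≤ |(thinQuad p).im| := by rw [him, abs_of_nonneg (by linarith)]; linarith
      _ ≤ ‖thinQuad p‖ := Complex.abs_im_le_norm _
  · calc ‖thinQuad p‖ ≤ |(thinQuad p).re| + |(thinQuad p).im| := Complex.norm_le_abs_re_add_abs_im _
      _ ≤ 1 / 10 + 11 / 10 := by
          gcongr
          · rw [hre, abs_le]; constructor <;> linarith
          · rw [him, abs_of_nonneg (by linarith)]; linarith
      _ = 6 / 5 := by norm_num

/-- The unit circle crosses `thinQuad`: the arc `x ↦ x + i√(1 - x²)`, `x ∈ [-1/10, 1/10]`. [folklore] -/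
theorem thinQuad_mem_Sstar : thinQuad ∈ Sstar := by
  -- the arc
  set γ : ℝ → ℂ := fun x => (x : ℂ) + ((Real.sqrt (1 - x ^ 2) : ℝ) : ℂ) * Complex.I with hγ
  have hγc : Continuous γ := by fun_prop
  have hsq : ∀ x : ℝ, x ∈ Icc (-1 / 10 : ℝ) (1 / 10) → (99 / 100 : ℝ) ≤ 1 - x ^ 2 := fun x hx => by
    nlinarith [hx.1, hx.2]
  have hsqrt_ge : ∀ x : ℝ, x ∈ Icc (-1 / 10 : ℝ) (1 / 10) → (9 / 10 : ℝ) ≤ Real.sqrt (1 - x ^ 2) :=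
    fun x hx => by
      have : Real.sqrt ((9 / 10 : ℝ) ^ 2) ≤ Real.sqrt (1 - x ^ 2) :=
        Real.sqrt_le_sqrt (by nlinarith [hsq x hx])
      rwa [Real.sqrt_sq (by norm_num)] at this
  have hsqrt_le : ∀ x : ℝ, Real.sqrt (1 - x ^ 2) ≤ 1 := fun x => by
    rw [Real.sqrt_le_one]; nlinarith
  -- preimage parameters
  have hparam : ∀ x : ℝ, x ∈ Icc (-1 / 10 : ℝ) (1 / 10) →
      ∃ p : unitInterval × unitInterval, (p.1 : ℝ) = 5 * x + 1 / 2 ∧ thinQuad p = γ x := by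
    intro x hx
    have ha : 5 * x + 1 / 2 ∈ Icc (0 : ℝ) 1 := ⟨by linarith [hx.1], by linarith [hx.2]⟩
    have hb : 5 * Real.sqrt (1 - x ^ 2) - 9 / 2 ∈ Icc (0 : ℝ) 1 :=
      ⟨by linarith [hsqrt_ge x hx], by linarith [hsqrt_le x]⟩
    refine ⟨(⟨_, ha⟩, ⟨_, hb⟩), rfl, ?_⟩
    rw [thinQuad_apply, hγ]
    apply Complex.ext
    · simp only [(Quad.re_im_ofReal_add_ofReal_mul_I _ _).1]; ring
    · simp only [(Quad.re_im_ofReal_add_ofReal_mul_I _ _).2]; ring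
  refine mem_crossConfig_of_isCrossing (K := γ '' Icc (-1 / 10 : ℝ) (1 / 10)) ⟨?_, ?_, ?_, ?_, ?_⟩ ?_
  · exact (isCompact_Icc.image hγc)
  · exact (isConnected_Icc (by norm_num)).image _ hγc.continuousOn
  · rintro _ ⟨x, hx, rfl⟩
    obtain ⟨p, -, hp⟩ := hparam x hx
    exact ⟨p, hp⟩
  · obtain ⟨p, hp1, hp⟩ := hparam (-1 / 10) ⟨by norm_num, by norm_num⟩
    refine ⟨γ (-1 / 10), mem_image_of_mem _ ⟨by norm_num, by norm_num⟩, p, ?_, hp⟩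
    show p.1 = 0
    refine Subtype.ext ?_
    rw [hp1]; norm_num
  · obtain ⟨p, hp1, hp⟩ := hparam (1 / 10) ⟨by norm_num, by norm_num⟩
    refine ⟨γ (1 / 10), mem_image_of_mem _ ⟨by norm_num, by norm_num⟩, p, ?_, hp⟩
    show p.1 = 1
    refine Subtype.ext ?_
    rw [hp1]; norm_num
  · rintro _ ⟨x, hx, rfl⟩
    refine ⟨0, ?_⟩
    rw [zpow_zero, hγ]
    simp only
    rw [Complex.norm_eq_sqrt_sq_add_sq, (Quad.re_im_ofReal_add_ofReal_mul_I _ _).1,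
      (Quad.re_im_ofReal_add_ofReal_mul_I _ _).2, Real.sq_sqrt (by linarith [hsq x hx])]
    simp

/-- `thinQuad` is NOT crossed by `S_3 S⋆`: every quad within uniform distance `1/20` of it lives in
the annulus `17/20 < |z| < 5/4`, which `3E⋆` misses. [folklore] -/
theorem thinQuad_not_mem_dilate_three_Sstar : thinQuad ∉ QuadConfig.dilate 3 three_ne_zero Sstar := by
  rw [dilate_three_Sstar]
  intro hmem
  have hcl : thinQuad ∈ closure {Q : Quad (univ : Set ℂ) |
      ∃ K, Q.IsCrossing K ∧ K ⊆ {z | ∃ n : ℤ, ‖z‖ = 3 * (2 : ℝ) ^ n}} := by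
    rw [← coe_crossConfig]; exact hmem
  rw [Metric.mem_closure_iff] at hcl
  obtain ⟨Q, ⟨K, hK, hKE⟩, hdist⟩ := hcl (1 / 20) (by norm_num)
  obtain ⟨w, hwK, hwside⟩ := hK.2.2.2.1
  obtain ⟨z, -, rfl⟩ : ∃ z : unitInterval × unitInterval, z.1 = 0 ∧ Q z = w := hwside
  obtain ⟨n, hn⟩ := hKE hwK
  have hd : dist (thinQuad z) (Q z) < 1 / 20 := (Quad.dist_apply_le thinQuad Q z).trans_lt hdist
  rw [dist_eq_norm] at hd
  obtain ⟨hlo, hhi⟩ := norm_thinQuad_mem z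
  have h1 := norm_sub_norm_le (thinQuad z) (Q z)
  have h2 := norm_sub_norm_le (Q z) (thinQuad z)
  rw [norm_sub_rev] at h2
  refine not_mem_annulus_three_mul_zpow n ⟨?_, ?_⟩
  · rw [← hn]; linarith
  · rw [← hn]; linarith

/-- `S_3 S⋆ ≠ S⋆`. [folklore] -/
theorem dilate_three_Sstar_ne : QuadConfig.dilate 3 three_ne_zero Sstar ≠ Sstar := fun h =>
  thinQuad_not_mem_dilate_three_Sstar (by rw [h]; exact thinQuad_mem_Sstar)

/-- The Dirac law at a configuration (local copy). [folklore] -/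
def diracLaw' (S : QuadConfig (univ : Set ℂ)) : FiniteMeasure (QuadConfig (univ : Set ℂ)) :=
  ⟨Measure.dirac S, inferInstance⟩

/-- Push-forward of a Dirac law. [folklore] -/
theorem map_diracLaw' (T : QuadConfig (univ : Set ℂ) → QuadConfig (univ : Set ℂ))
    (S : QuadConfig (univ : Set ℂ)) : (diracLaw' S).map T = diracLaw' (T S) := by
  apply FiniteMeasure.toMeasure_injective
  rw [FiniteMeasure.toMeasure_map, diracLaw', diracLaw', FiniteMeasure.toMeasure_mk,
    FiniteMeasure.toMeasure_mk, Measure.map_dirac]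

/-- **An abstract limit-cycle law exists on `ℋ_ℂ`**: a probability law invariant under all rotations
and under `S_2`, but not under `S_3`. [folklore] -/
theorem exists_rotationInvariant_lagTwo_not_lagThree :
    ∃ μ : FiniteMeasure (QuadConfig (univ : Set ℂ)), μ.mass = 1 ∧
      (∀ α : ℝ, μ.map (QuadConfig.rotate α) = μ) ∧
      dilateLaw 2 two_ne_zero μ = μ ∧ dilateLaw 3 three_ne_zero μ ≠ μ := by
  refine ⟨diracLaw' Sstar, ?_, fun α => ?_, ?_, ?_⟩
  · have : ((diracLaw' Sstar).mass : ℝ≥0∞) = 1 := by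
      rw [FiniteMeasure.ennreal_mass, diracLaw', FiniteMeasure.toMeasure_mk, measure_univ]
    exact_mod_cast this
  · rw [map_diracLaw', rotate_Sstar]
  · rw [dilateLaw, map_diracLaw', dilate_two_Sstar]
  · rw [dilateLaw, map_diracLaw']
    intro h
    have := congrArg (fun ν : FiniteMeasure (QuadConfig (univ : Set ℂ)) =>
      (ν : Measure (QuadConfig (univ : Set ℂ))) (QuadConfig.crossedEvent thinQuad)) h
    simp only [diracLaw', FiniteMeasure.toMeasure_mk,
      Measure.dirac_apply' _ (QuadConfig.measurableSet_crossedEvent _)] at this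
    rw [Set.indicator_of_notMem (fun h' => thinQuad_not_mem_dilate_three_Sstar
        (QuadConfig.mem_crossedEvent.mp h')),
      Set.indicator_of_mem (QuadConfig.mem_crossedEvent.mpr thinQuad_mem_Sstar)] at this
    exact zero_ne_one this

/-- **Lag `3` is load-bearing in `TwoLagsAllLags`, even granted rotation invariance**: invariance
under all rotations and under `S_2` does NOT imply invariance under all dilations (for laws on `ℋ_ℂ`).
[folklore] -/
theorem not_allLags_of_rotation_and_lagTwo :
    ¬ ∀ μ : FiniteMeasure (QuadConfig (univ : Set ℂ)), μ.mass = 1 →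
      (∀ α : ℝ, μ.map (QuadConfig.rotate α) = μ) → dilateLaw 2 two_ne_zero μ = μ →
        ∀ (t : ℝ) (ht : 0 < t), dilateLaw t ht.ne' μ = μ := by
  intro h
  obtain ⟨μ, hmass, hrot, h2, h3⟩ := exists_rotationInvariant_lagTwo_not_lagThree
  exact h3 (h μ hmass hrot h2 3 three_pos)

/-- **Rotation invariance does not imply dilation invariance** (for laws on `ℋ_ℂ`): the symmetry
supplied by `RotationInput` (DKKMO) is logically independent of the crux at the level of single
laws — "rotation invariance does not exclude an RG limit cycle", as a theorem. [folklore] -/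
theorem not_dilationInvariant_of_rotationInvariant :
    ¬ ∀ μ : FiniteMeasure (QuadConfig (univ : Set ℂ)), μ.mass = 1 →
      (∀ α : ℝ, μ.map (QuadConfig.rotate α) = μ) → ∀ (t : ℝ) (ht : 0 < t), dilateLaw t ht.ne' μ = μ :=
  fun h => not_allLags_of_rotation_and_lagTwo fun μ hm hr _ => h μ hm hr

/-! ## §8  NO FINITE LIMIT CYCLE: `Λ` is connected, hence a single point or infinite

The item's failure picture — "an RG limit cycle: several limit points permuted by `S_t`" — is
impossible in its finite form.  `δ ↦ μ_δ` is weakly continuous on `(0, ∞)` (`S_t μ_1 = μ_t` and the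
dilation action is continuous in `t` against test functions, by dominated convergence), so
`Λ = ⋂ₙ closure {μ_δ : 0 < δ < 1/(n+1)}` is a decreasing intersection of continua in the compact
metrizable space of probability laws on `ℋ_ℂ`, hence CONNECTED (`isPreconnected_subseqQuadLimits`).
A connected Hausdorff set with two points is infinite: `subseqQuadLimits_subsingleton_or_infinite`.
In particular any failure of the crux comes with infinitely many distinct subsequential limits
(`infinite_subseqQuadLimits_of_not_scaleInvariantLimits`). -/

section Topology

variable {X : Type*} [TopologicalSpace X] [T2Space X]

/-- **A decreasing intersection of compact connected sets is connected** (in a Hausdorff space).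
[folklore] -/
theorem isPreconnected_iInter_of_antitone_isCompact (K : ℕ → Set X)
    (hanti : ∀ n, K (n + 1) ⊆ K n) (hcomp : ∀ n, IsCompact (K n)) (hclosed : ∀ n, IsClosed (K n))
    (hconn : ∀ n, IsPreconnected (K n)) : IsPreconnected (⋂ n, K n) := by
  rw [isPreconnected_closed_iff]
  intro t t' ht ht' hcover hLt hLt'
  by_contra hempty
  rw [not_nonempty_iff_eq_empty] at hempty
  set L := ⋂ n, K n with hL
  have hLclosed : IsClosed L := isClosed_iInter hclosed
  have hLcomp : IsCompact L := (hcomp 0).of_isClosed_subset hLclosed (iInter_subset _ 0)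
  -- the two pieces
  have hA : IsCompact (L ∩ t) := hLcomp.inter_right ht
  have hB : IsCompact (L ∩ t') := hLcomp.inter_right ht'
  have hdisj : Disjoint (L ∩ t) (L ∩ t') := by
    rw [Set.disjoint_iff_inter_eq_empty, ← hempty]; ext x; simp [and_assoc, and_left_comm]
  obtain ⟨U, V, hU, hV, hAU, hBV, hUV⟩ := SeparatedNhds.of_isCompact_isCompact hA hB hdisj
  -- `K n \ (U ∪ V)` is a decreasing sequence of compact closed sets with empty intersection
  have hsub : L ⊆ U ∪ V := fun x hx => by
    rcases hcover hx with hxt | hxt'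
    · exact Or.inl (hAU ⟨hx, hxt⟩)
    · exact Or.inr (hBV ⟨hx, hxt'⟩)
  have hex : ∃ N, K N \ (U ∪ V) = ∅ := by
    by_contra hne
    push Not at hne
    have h := IsCompact.nonempty_iInter_of_sequence_nonempty_isCompact_isClosed
      (fun n => K n \ (U ∪ V)) (fun n x hx => ⟨hanti n hx.1, hx.2⟩)
      (fun n => hne n) ((hcomp 0).diff (hU.union hV))
      (fun n => (hclosed n).sdiff (hU.union hV))
    obtain ⟨x, hx⟩ := h
    rw [mem_iInter] at hx
    have hxL : x ∈ L := mem_iInter.mpr fun n => (hx n).1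
    exact (hx 0).2 (hsub hxL)
  obtain ⟨N, hN⟩ := hex
  have hKN : K N ⊆ U ∪ V := fun x hx => by
    by_contra hx'
    have : x ∈ K N \ (U ∪ V) := ⟨hx, hx'⟩
    rw [hN] at this
    exact this
  have hLN : L ⊆ K N := iInter_subset _ N
  rcases (hconn N).subset_or_subset hU hV hUV hKN with h | h
  · obtain ⟨x, hxL, hxt'⟩ := hLt'
    exact Set.disjoint_left.mp hUV (h (hLN hxL)) (hBV ⟨hxL, hxt'⟩)
  · obtain ⟨x, hxL, hxt⟩ := hLt
    exact Set.disjoint_left.mp hUV.symm (h (hLN hxL)) (hAU ⟨hxL, hxt⟩)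

end Topology

/-! ### Weak continuity of the dilation action in the scale parameter -/

/-- Dilations `z ↦ c z` converge to the identity locally uniformly as `c → 1`. [folklore] -/
theorem tendstoUniformlyOn_mul_of_tendsto_one {ι : Type*} {l : Filter ι} {c : ι → ℂ}
    (hc : Tendsto c l (𝓝 1)) {K : Set ℂ} (hK : IsCompact K) :
    TendstoUniformlyOn (fun i z => c i * z) id l K := by
  obtain ⟨R, hR⟩ := hK.isBounded.subset_closedBall 0 |>.imp fun R h => h
  rw [Metric.tendstoUniformlyOn_iff]
  intro ε hε
  have hR0 : 0 ≤ max R 1 := le_trans zero_le_one (le_max_right _ _)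
  have hev : ∀ᶠ i in l, dist (c i) 1 < ε / max R 1 :=
    (Metric.tendsto_nhds.mp hc) _ (div_pos hε (lt_of_lt_of_le zero_lt_one (le_max_right _ _)))
  filter_upwards [hev] with i hi z hz
  have hzR : ‖z‖ ≤ max R 1 := (mem_closedBall_zero_iff.mp (hR hz)).trans (le_max_left _ _)
  rw [dist_comm, dist_eq_norm, show c i * z - id z = (c i - 1) * z by simp [sub_mul], norm_mul]
  rw [dist_eq_norm] at hi
  calc ‖c i - 1‖ * ‖z‖ ≤ ‖c i - 1‖ * max R 1 := mul_le_mul_of_nonneg_left hzR (norm_nonneg _)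
    _ < ε / max R 1 * max R 1 := mul_lt_mul_of_pos_right hi (lt_of_lt_of_le zero_lt_one (le_max_right _ _))
    _ = ε := div_mul_cancel₀ ε (ne_of_gt (lt_of_lt_of_le zero_lt_one (le_max_right _ _)))

/-- **Weak continuity of `c ↦ c · μ` at `c = 1`** along non-vanishing scale factors: if `c i → 1`
then `μ ∘ (z ↦ c_i z)⁻¹ → μ` weakly, for every finite law `μ` on `ℋ_ℂ` (pointwise continuity of
the action `QuadConfig.tendsto_mapHomeomorph_of_tendstoUniformlyOn` + dominated convergence).
[folklore] -/
theorem tendsto_map_mulLeft_of_tendsto_one {ι : Type*} {l : Filter ι} [l.IsCountablyGenerated]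
    {c : ι → ℂ} (hc0 : ∀ i, c i ≠ 0) (hc : Tendsto c l (𝓝 1))
    (μ : FiniteMeasure (QuadConfig (univ : Set ℂ))) :
    Tendsto (fun i => μ.map (QuadConfig.mapHomeomorph (Homeomorph.mulLeft₀ (c i) (hc0 i)))) l
      (𝓝 μ) := by
  have hpt : ∀ S : QuadConfig (univ : Set ℂ),
      Tendsto (fun i => S.mapHomeomorph (Homeomorph.mulLeft₀ (c i) (hc0 i))) l (𝓝 S) := by
    intro S
    refine QuadConfig.tendsto_mapHomeomorph_of_tendstoUniformlyOn _ (fun K hK => ?_) (fun K hK => ?_) S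
    · simpa [Homeomorph.coe_mulLeft₀] using tendstoUniformlyOn_mul_of_tendsto_one hc hK
    · have hc' : Tendsto (fun i => (c i)⁻¹) l (𝓝 1) := by simpa using hc.inv₀ one_ne_zero
      have := tendstoUniformlyOn_mul_of_tendsto_one hc' hK
      refine this.congr (Eventually.of_forall fun i => ?_)
      intro z hz
      simp [Homeomorph.mulLeft₀_symm_apply]
  rw [FiniteMeasure.tendsto_iff_forall_integral_tendsto]
  intro f
  have hmeas : ∀ i, Measurable (QuadConfig.mapHomeomorph (Homeomorph.mulLeft₀ (c i) (hc0 i)) :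
      QuadConfig (univ : Set ℂ) → QuadConfig univ) := fun i => QuadConfig.measurable_mapHomeomorph _
  have hint : ∀ i, ∫ S, f S ∂((μ.map (QuadConfig.mapHomeomorph (Homeomorph.mulLeft₀ (c i) (hc0 i))) :
      FiniteMeasure (QuadConfig (univ : Set ℂ))) : Measure (QuadConfig (univ : Set ℂ))) =
      ∫ S, f (QuadConfig.mapHomeomorph (Homeomorph.mulLeft₀ (c i) (hc0 i)) S)
        ∂(μ : Measure (QuadConfig (univ : Set ℂ))) := fun i => by
    rw [FiniteMeasure.toMeasure_map, integral_map (hmeas i).aemeasurable f.continuous.aestronglyMeasurable]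
  simp_rw [hint]
  refine tendsto_integral_filter_of_dominated_convergence (fun _ => ‖f‖) ?_ ?_ ?_ ?_
  · exact Eventually.of_forall fun i =>
      (f.continuous.comp (QuadConfig.continuous_mapHomeomorph _)).aestronglyMeasurable
  · exact Eventually.of_forall fun i => ae_of_all _ fun S => f.norm_coe_le_norm _
  · exact integrable_const _
  · exact ae_of_all _ fun S => (f.continuous.tendsto S).comp (hpt S)

/-- **`δ ↦ μ_δ` is weakly continuous on `(0, ∞)`** (as finite laws on `ℋ_ℂ`). [folklore] -/
theorem continuousOn_z2QuadLaw : ContinuousOn (fun δ : ℝ => z2QuadLaw univ δ) (Ioi 0) := by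
  intro δ₀ hδ₀
  have hδ₀' : (δ₀ : ℝ) ≠ 0 := ne_of_gt hδ₀
  -- along `𝓝[Ioi 0] δ₀` the scale factors `δ/δ₀` do not vanish and tend to `1`
  have key : Tendsto (fun δ : {δ : ℝ // 0 < δ} => z2QuadLaw univ (δ : ℝ))
      (comap Subtype.val (𝓝[Ioi 0] δ₀)) (𝓝 (z2QuadLaw univ δ₀)) := by
    have hc0 : ∀ δ : {δ : ℝ // 0 < δ}, ((δ : ℝ) / δ₀ : ℂ) ≠ 0 := fun δ => by
      exact_mod_cast div_ne_zero (ne_of_gt δ.2) hδ₀'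
    haveI : (comap (Subtype.val : {δ : ℝ // 0 < δ} → ℝ) (𝓝[Ioi 0] δ₀)).IsCountablyGenerated :=
      inferInstance
    have hc : Tendsto (fun δ : {δ : ℝ // 0 < δ} => ((δ : ℝ) / δ₀ : ℂ))
        (comap Subtype.val (𝓝[Ioi 0] δ₀)) (𝓝 1) := by
      have h1 : Tendsto (fun δ : ℝ => ((δ / δ₀ : ℝ) : ℂ)) (𝓝[Ioi 0] δ₀) (𝓝 1) := by
        have : Tendsto (fun δ : ℝ => δ / δ₀) (𝓝[Ioi 0] δ₀) (𝓝 1) := by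
          rw [← div_self hδ₀']
          exact (tendsto_id.mono_left nhdsWithin_le_nhds).div_const δ₀
        simpa [Function.comp_def] using (Complex.continuous_ofReal.tendsto 1).comp this
      have h2 := h1.comp (tendsto_comap (f := (Subtype.val : {δ : ℝ // 0 < δ} → ℝ)))
      refine h2.congr fun δ => ?_
      simp
    have h := tendsto_map_mulLeft_of_tendsto_one hc0 hc (z2QuadLaw univ δ₀)
    refine h.congr fun δ => ?_
    have hmul := z2QuadLaw_map_dilate (t := (δ : ℝ) / δ₀) (div_ne_zero (ne_of_gt δ.2) hδ₀') δ₀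
    rw [div_mul_cancel₀ _ hδ₀'] at hmul
    rw [← hmul, QuadConfig.dilate]
    congr
    push_cast
    rfl
  -- transfer from the subtype filter to `𝓝[Ioi 0] δ₀`
  rw [ContinuousWithinAt]
  have hmap : map (Subtype.val : {δ : ℝ // 0 < δ} → ℝ) (comap Subtype.val (𝓝[Ioi 0] δ₀)) =
      𝓝[Ioi 0] δ₀ := by
    apply map_comap_of_mem
    rw [Subtype.range_coe_subtype]
    exact self_mem_nhdsWithin
  rw [← hmap, tendsto_map'_iff]
  exact key

/-! ### `Λ` as a decreasing intersection of continua of probability laws -/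

/-- The scaling family as probability laws on `ℋ_ℂ` (`δ > 0`; junk value `μ_1` elsewhere). [folklore] -/
def lawP (δ : ℝ) : ProbabilityMeasure (QuadConfig (univ : Set ℂ)) :=
  if h : 0 < δ then ⟨(z2QuadLaw univ δ : Measure (QuadConfig (univ : Set ℂ))),
      isProbabilityMeasure_z2QuadLaw_of_pos isOpen_univ h⟩
  else ⟨(z2QuadLaw univ 1 : Measure (QuadConfig (univ : Set ℂ))),
      isProbabilityMeasure_z2QuadLaw_of_pos isOpen_univ one_pos⟩

/-- `lawP δ` is `μ_δ` for `δ > 0`. [folklore] -/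
theorem toFiniteMeasure_lawP {δ : ℝ} (hδ : 0 < δ) : (lawP δ).toFiniteMeasure = z2QuadLaw univ δ := by
  rw [lawP, dif_pos hδ]; rfl

/-- `δ ↦ μ_δ` is continuous on `(0, ∞)` as probability laws. [folklore] -/
theorem continuousOn_lawP : ContinuousOn lawP (Ioi 0) := by
  intro δ₀ hδ₀
  rw [ContinuousWithinAt, ProbabilityMeasure.tendsto_nhds_iff_toFiniteMeasure_tendsto_nhds,
    toFiniteMeasure_lawP hδ₀]
  refine (continuousOn_z2QuadLaw δ₀ hδ₀).congr' ?_
  filter_upwards [self_mem_nhdsWithin] with δ hδ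
  exact (toFiniteMeasure_lawP hδ).symm

/-- Membership in `Λ` in terms of the probability-law family. [folklore] -/
theorem toFiniteMeasure_mem_subseqQuadLimits_iff (π : ProbabilityMeasure (QuadConfig (univ : Set ℂ))) :
    π.toFiniteMeasure ∈ subseqQuadLimits (univ : Set ℂ) ↔
      ∃ δs : ℕ → ℝ, (∀ k, 0 < δs k) ∧ Tendsto δs atTop (𝓝 0) ∧
        Tendsto (fun k => lawP (δs k)) atTop (𝓝 π) := by
  rw [show (π.toFiniteMeasure ∈ subseqQuadLimits (univ : Set ℂ)) =
    IsSubseqQuadLimit univ π.toFiniteMeasure from rfl, isSubseqQuadLimit_iff]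
  constructor
  · rintro ⟨δs, hpos, h0, hlim⟩
    refine ⟨δs, hpos, h0, ?_⟩
    rw [ProbabilityMeasure.tendsto_nhds_iff_toFiniteMeasure_tendsto_nhds]
    have : (ProbabilityMeasure.toFiniteMeasure ∘ fun k => lawP (δs k)) = fun k => z2QuadLaw univ (δs k) :=
      funext fun k => toFiniteMeasure_lawP (hpos k)
    rw [this]; exact hlim
  · rintro ⟨δs, hpos, h0, hlim⟩
    refine ⟨δs, hpos, h0, ?_⟩
    rw [ProbabilityMeasure.tendsto_nhds_iff_toFiniteMeasure_tendsto_nhds] at hlim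
    have : (ProbabilityMeasure.toFiniteMeasure ∘ fun k => lawP (δs k)) = fun k => z2QuadLaw univ (δs k) :=
      funext fun k => toFiniteMeasure_lawP (hpos k)
    rw [this] at hlim; exact hlim

/-- **`Λ = ⋂ₙ closure {μ_δ : 0 < δ < 1/(n+1)}`** (as probability laws). [folklore] -/
theorem setOf_mem_subseqQuadLimits_eq_iInter :
    {π : ProbabilityMeasure (QuadConfig (univ : Set ℂ)) | π.toFiniteMeasure ∈ subseqQuadLimits (univ : Set ℂ)} =
      ⋂ n : ℕ, closure (lawP '' Ioo 0 (1 / ((n : ℝ) + 1))) := by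
  letI : MetricSpace (QuadConfig (univ : Set ℂ)) :=
    TopologicalSpace.metrizableSpaceMetric (QuadConfig (univ : Set ℂ))
  letI : PseudoMetricSpace (ProbabilityMeasure (QuadConfig (univ : Set ℂ))) :=
    TopologicalSpace.pseudoMetrizableSpacePseudoMetric _
  ext π
  simp only [mem_setOf_eq, mem_iInter]
  constructor
  · intro hπ n
    obtain ⟨δs, hpos, h0, hlim⟩ := (toFiniteMeasure_mem_subseqQuadLimits_iff π).mp hπ
    refine mem_closure_of_tendsto hlim ?_
    have hev : ∀ᶠ k in atTop, δs k < 1 / ((n : ℝ) + 1) := by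
      have := (Metric.tendsto_nhds.mp h0) (1 / ((n : ℝ) + 1)) (by positivity)
      filter_upwards [this] with k hk
      rwa [Real.dist_0_eq_abs, abs_of_pos (hpos k)] at hk
    filter_upwards [hev] with k hk
    exact ⟨δs k, ⟨hpos k, hk⟩, rfl⟩
  · intro h
    have hx : ∀ n : ℕ, ∃ δ, δ ∈ Ioo (0 : ℝ) (1 / ((n : ℝ) + 1)) ∧ dist (lawP δ) π < 1 / ((n : ℝ) + 1) := by
      intro n
      obtain ⟨y, ⟨δ, hδ, rfl⟩, hyd⟩ :=
        Metric.mem_closure_iff.mp (h n) (1 / ((n : ℝ) + 1)) (by positivity)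
      exact ⟨δ, hδ, by rwa [dist_comm]⟩
    choose δs hδs hdist using hx
    refine (toFiniteMeasure_mem_subseqQuadLimits_iff π).mpr ⟨δs, fun k => (hδs k).1, ?_, ?_⟩
    · exact squeeze_zero (fun k => (hδs k).1.le) (fun k => (hδs k).2.le)
        tendsto_one_div_add_atTop_nhds_zero_nat
    · rw [tendsto_iff_dist_tendsto_zero]
      exact squeeze_zero (fun k => dist_nonneg) (fun k => (hdist k).le)
        tendsto_one_div_add_atTop_nhds_zero_nat

/-- **`Λ` is connected** (as probability laws): a decreasing intersection of the continua
`closure {μ_δ : 0 < δ < 1/(n+1)}` in the compact metrizable space of probability laws on `ℋ_ℂ`.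
[folklore] -/
theorem isPreconnected_setOf_mem_subseqQuadLimits :
    IsPreconnected {π : ProbabilityMeasure (QuadConfig (univ : Set ℂ)) |
      π.toFiniteMeasure ∈ subseqQuadLimits (univ : Set ℂ)} := by
  letI : MetricSpace (QuadConfig (univ : Set ℂ)) :=
    TopologicalSpace.metrizableSpaceMetric (QuadConfig (univ : Set ℂ))
  rw [setOf_mem_subseqQuadLimits_eq_iInter]
  refine isPreconnected_iInter_of_antitone_isCompact _ (fun n => ?_) (fun n => ?_) (fun n => ?_)
    (fun n => ?_)
  · refine closure_mono (image_mono (Ioo_subset_Ioo le_rfl ?_))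
    exact one_div_le_one_div_of_le (by positivity) (by push_cast; linarith)
  · exact isClosed_closure.isCompact
  · exact isClosed_closure
  · exact (isPreconnected_Ioo.image _ (continuousOn_lawP.mono Ioo_subset_Ioi_self)).closure

/-- `Λ` consists of probability laws: it is the image of its probability-law incarnation. [folklore] -/
theorem subseqQuadLimits_eq_image :
    subseqQuadLimits (univ : Set ℂ) =
      ProbabilityMeasure.toFiniteMeasure ''
        {π : ProbabilityMeasure (QuadConfig (univ : Set ℂ)) |
          π.toFiniteMeasure ∈ subseqQuadLimits (univ : Set ℂ)} := by
  ext μ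
  constructor
  · intro hμ
    haveI := isProbabilityMeasure_of_isSubseqQuadLimit isOpen_univ hμ
    set π : ProbabilityMeasure (QuadConfig (univ : Set ℂ)) :=
      ⟨(μ : Measure (QuadConfig (univ : Set ℂ))), this⟩ with hπ
    have hc : ProbabilityMeasure.toFiniteMeasure π = μ := Subtype.ext rfl
    exact ⟨π, by rw [mem_setOf_eq, hc]; exact hμ, hc⟩
  · rintro ⟨π, hπ, rfl⟩
    exact hπ

/-- **`Λ ⊆ FiniteMeasure ℋ_ℂ` is connected.** [folklore] -/
theorem isPreconnected_subseqQuadLimits : IsPreconnected (subseqQuadLimits (univ : Set ℂ)) := by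
  rw [subseqQuadLimits_eq_image]
  exact isPreconnected_setOf_mem_subseqQuadLimits.image _
    (ProbabilityMeasure.toFiniteMeasure_continuous.continuousOn)

/-- **NO FINITE LIMIT CYCLE**: the set of subsequential scaling limits of critical bond-`ℤ²`
crossing laws is a single point or infinite. [folklore] -/
theorem subseqQuadLimits_subsingleton_or_infinite :
    (subseqQuadLimits (univ : Set ℂ)).Subsingleton ∨ (subseqQuadLimits (univ : Set ℂ)).Infinite := by
  letI : MetricSpace (QuadConfig (univ : Set ℂ)) :=
    TopologicalSpace.metrizableSpaceMetric (QuadConfig (univ : Set ℂ))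
  by_cases h : (subseqQuadLimits (univ : Set ℂ)).Subsingleton
  · exact Or.inl h
  · exact Or.inr (isPreconnected_subseqQuadLimits.infinite_of_nontrivial (not_subsingleton_iff.mp h))

/-- The failure picture "finitely many limit points permuted by `S_t`" is impossible. [folklore] -/
theorem not_finite_nontrivial_subseqQuadLimits :
    ¬ ((subseqQuadLimits (univ : Set ℂ)).Finite ∧ (subseqQuadLimits (univ : Set ℂ)).Nontrivial) := by
  rintro ⟨hfin, hnt⟩
  rcases subseqQuadLimits_subsingleton_or_infinite with h | h
  · exact hnt.not_subsingleton h
  · exact h hfin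

/-- **Any failure of the crux produces infinitely many distinct subsequential limits.** [folklore] -/
theorem infinite_subseqQuadLimits_of_not_scaleInvariantLimits (h : ¬ ScaleInvariantLimits) :
    (subseqQuadLimits (univ : Set ℂ)).Infinite := by
  unfold ScaleInvariantLimits at h
  push Not at h
  obtain ⟨μ, hμ, t, ht, hne⟩ := h
  refine subseqQuadLimits_subsingleton_or_infinite.resolve_left fun hs => hne ?_
  exact hs (dilateLaw_mem_subseqQuadLimits hμ ht) hμ

end Summit.CriticalPhenomena.CardyFormulaZ2.Cruxes.ScaleInvariantLimits.Disproof
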